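import Literature.NumberTheory.EllipticCurves.RohrlichNonvanishing
import Literature.NumberTheory.EllipticCurves.PAdicLFunctionNonvanishingProofs
import Literature.NumberTheory.EllipticCurves.ModularSymbolsEichlerShimuraHoldsProofs
import Mathlib.RingTheory.Polynomial.Cyclotomic.Roots
import Mathlib.RingTheory.RootsOfUnity.Complex
import Mathlib.RingTheory.ZMod.UnitsCyclic
import Mathlib.NumberTheory.Multiplicity
import HarnessLib

/-!
# Rohrlich's non-vanishing theorem for twists of `p`-power conductor — the rational case, proved

Topic `NumberTheory/EllipticCurves` (companion of `RohrlichNonvanishing`, whose named fact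
`Rohrlich1984_nonvanishing_twists` — Rohrlich 1984, Theorem p. 409, for *every* newform on
`Γ₀(N)` and every finite set `P` of primes — stays a named fact). This file **proves** the case
that carries the title of Rohrlich's paper: for a normalised newform `f ∈ S₂(Γ₀(N))` with
*rational* Fourier coefficients and a coefficient bound `|aₙ| ≤ C n^θ`, `θ < 2/3` (in particular
for the newform of an elliptic curve `E/ℚ`, by Hasse), and a prime `p ∤ N`, only finitely many
primitive Dirichlet characters `χ` of `p`-power conductor have `L(f, χ, 1) = 0`:

* `Rohrlich1984_primePow_of_coeffField_eq_bot` — the statement above, with the conclusion in the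
  exact form of `Rohrlich1984_nonvanishing_twists.primePow`;
* `Rohrlich1984_primePow_of_isNewformOf` — the same for `f` the newform of an elliptic curve
  `W/ℚ` (`IsNewformOf W f`), with no further hypothesis (Rohrlich's theorem for `E/ℚ` and
  `P = {p}`, all primes `p ∤ N`);
* `Rohrlich1984_oddPrimePow_of_coeffField_eq_bot`, `Rohrlich1984_oddPrimePow_of_isNewformOf` — the
  cases `p ≠ 2`, kept under their own names;
* `Rohrlich1984_nonvanishing_twists.primePow_of_coeffField_eq_bot`,
  `Rohrlich1984_nonvanishing_twists.primePow_of_isNewformOf` — the hypotheses of the corollary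
  `Rohrlich1984_nonvanishing_twists.primePow` of the named fact verbatim (`p ∤ N` any natural
  number), for rational newforms, resp. newforms of elliptic curves: that corollary, proved in the
  rational case.

## The argument (Rohrlich 1984, §§1–4, run on modular symbols)

Write `S(χ) = ∑_{a mod p^m} χ(a){∞, a/p^m}_f` (`twistedSymbolSum`), so that
`τ(χ̄) L(f, χ, 1) = S(χ̄)` for primitive `χ` (Birch; `twisted_LValue_eq_holds`).

1. *Galois conjugation* (`twistedSymbolSum_pow_eq_zero_of_coprime`, Rohrlich §1 with `K_f = ℚ`):
   for a rational newform, `S(χ) = 0` implies `S(χ^k) = 0` for all `k` prime to the order `d` of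
   `χ`. By parity `S(χ)` is `Ω⁺_f ∑ χ(a)[a/p^m]⁺` or `iΩ⁻_f ∑ χ(a)[a/p^m]⁻` with *rational*
   `[·]^±` (Manin–Drinfeld and Eichler–Shimura, theorems of the tree:
   `IsNewform0.exists_rat_smul_plusPeriod_holds`, `..._minusPeriod_holds`), and a rational
   polynomial vanishing at `e^{2πi/d}` is divisible by `Φ_d`, hence vanishes at `e^{2πik/d}`
   (`sum_pow_apply_mul_eq_zero_of_coprime`).
2. *The family* (section `Coset`): the conjugates `χ^{1 + p(p-1)j}`, `0 ≤ j < ord(χ^{p(p-1)})`,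
   form a coset `χ⟨χ^{p(p-1)}⟩` of a group of characters; all are primitive of the parity of `χ`
   (`isPrimitive_pow_of_coprime`, `pow_apply_neg_one_of_coprime`), and by a geometric sum
   `∑_{ψ} ψ(z)` vanishes unless `χ(z)^{p(p-1)} = 1` (`sum_galoisCoset_apply`), which for
   primitive `χ` forces `z^{2(p-1)} ≡ 1 (mod p^{m-1})` (`castHom_pow_eq_one_of_apply_pow_eq_one`
   for odd `p`, via a generator of the cyclic group `(ℤ/p^m)ˣ`; `castHom_sq_eq_one_of_apply_sq_eq_one`
   for `p = 2`, via the four square roots of `1` mod `2^m`): a set of at most `4p²` residues, all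
   `≥ p^{(m-1)/(2(p-1))}` apart from `1`.
3. *The first moment over a sparse family* (`exists_forall_family_exists_twistedSymbolSum_ne_zero`):
   for any non-empty family `X` of primitive characters mod `p^m` of constant parity `ε` with
   character sum supported in that sparse set, the weighted moment
   `∑_{χ ∈ X} (τ(χ)/p^m) S(χ̄) = ε (D_f(A, Y) - p^{-m} D_g(B, Y'))`
   (`sum_family_twistedSymbolSum_eq`, from the two-sided series of `TwistedLValueSeries` for the
   Fricke pair `(f, g) = (f, w_N f)`, Rohrlich §2) equals `ε #X (e^{-2πY} + o(1))` as `m → ∞`,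
   uniformly in `X`: the main error by the sparseness and `|aₙ| ≤ C n^θ`, `θ < 2/3`
   (`norm_dampedTwist_sum_sub_le_of_support`, Rohrlich §3), the dual error by the Kloosterman
   bound for `∑_{χ ∈ X} χ(y)τ(χ)²` (`norm_sum_mul_gaussSum_sq_le_of_support`,
   `norm_dampedTwist_dual_le_of_support`; Rohrlich §4 uses explicit Gauss sums instead). Hence
   for `m ≥ m₀(f, p)` not all `S(χ̄)`, `χ ∈ X`, vanish.
4. *Assembly*: an exceptional `χ` of conductor `p^m`, `m ≥ m₀`, would by 1 kill `S` on the whole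
   family of 2 attached to `χ̄` (inverses of conjugates are conjugates), contradicting 3; so the
   exceptional characters have conductor `p^m`, `m < m₀` — finitely many.

What is *not* covered, and why the general fact is not discharged here: for newforms with
irrational coefficients the argument needs the Ramanujan–Petersson bound `θ < 2/3` for weight-2
newforms (Eichler–Shimura–Weil–Deligne) and Shimura's algebraicity of `L(f, χ, 1)` over the
coefficient field `K_f`, neither of which the tree has; composite conductors (general `P`) need
the harmonic analysis of 2–3 for `ℤ/Mℤ` with several prime factors.

## References

* D. E. Rohrlich, *On `L`-functions of elliptic curves and cyclotomic towers*, Invent. Math. 75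
  (1984), 409–423: Theorem (p. 409) and §§1–4; Zbl 0565.14006.
* G. Shimura, *On the periods of modular forms*, Math. Ann. 229 (1977), 211–221, Thm. 1
  (algebraicity; here only the rational case, through Manin–Drinfeld).
* B. Mazur, J. Tate, J. Teitelbaum, *On `p`-adic analogues of the conjectures of Birch and
  Swinnerton-Dyer*, Invent. Math. 84 (1986), §I.8 (Birch's formula, `[·]^±`).
* L. C. Washington, *Introduction to cyclotomic fields*, GTM 83, §7.2 (structure of `(ℤ/p^m)ˣ`).
-/

noncomputable section

open scoped BigOperators Real
open Finset Filter Topology Set MeasureTheory Polynomial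

namespace Literature.NumberTheory.EllipticCurves

variable {p : ℕ} [hp : Fact p.Prime]

/-! ### Galois conjugation of a vanishing rational combination of character values -/

/-- **Galois conjugation of a vanishing rational relation among character values.** If
`∑_a χ(a) q_a = 0` with rational `q_a`, then `∑_a χ^k(a) q_a = 0` for every `k` coprime to the
order `d` of `χ`: the values `χ(a)` are powers `ζ^{e_a}` of `ζ = e^{2πi/d}`, the rational
polynomial `∑ q_a X^{e_a}` vanishes at `ζ`, hence is divisible by the minimal polynomial `Φ_d` of
`ζ` over `ℚ`, which also vanishes at the primitive `d`-th root `ζ^k` (Rohrlich 1984, §1: the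
Galois conjugates `χ^σ`, `σ ∈ Gal(ℚ(μ_d)/ℚ)`, are the `χ^k`, `(k, d) = 1`). [folklore] -/
theorem sum_pow_apply_mul_eq_zero_of_coprime {M : ℕ} [NeZero M] (χ : DirichletCharacter ℂ M)
    (q : ZMod M → ℚ) (h : ∑ a : ZMod M, χ a * q a = 0) {k : ℕ} (hk : k.Coprime (orderOf χ)) :
    ∑ a : ZMod M, (χ ^ k) a * q a = 0 := by
  classical
  set d := orderOf χ with hd
  have hd0 : 0 < d := orderOf_pos χ
  haveI : NeZero d := ⟨hd0.ne'⟩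
  set ζ : ℂ := Complex.exp (2 * Real.pi * Complex.I / d) with hζ
  have hζprim : IsPrimitiveRoot ζ d := Complex.isPrimitiveRoot_exp d hd0.ne'
  -- each unit value is a power of `ζ`
  have hval : ∀ u : (ZMod M)ˣ, ∃ i < d, ζ ^ i = χ u := fun u ↦ by
    refine hζprim.eq_pow_of_pow_eq_one ?_
    rw [← MulChar.pow_apply_coe, hd, pow_orderOf_eq_one, MulChar.one_apply_coe]
  choose e _he_lt he using hval
  -- the rational polynomial `∑ q_u X^{e_u}`
  set P : ℚ[X] := ∑ u : (ZMod M)ˣ, C (q u) * X ^ (e u) with hP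
  have haeval : ∀ z : ℂ, aeval z P = ∑ u : (ZMod M)ˣ, (q u : ℂ) * z ^ (e u) := fun z ↦ by
    simp only [hP, map_sum, map_mul, aeval_C, map_pow, aeval_X, eq_ratCast]
  have hunits : ∀ ψ : DirichletCharacter ℂ M,
      ∑ a : ZMod M, ψ a * q a = ∑ u : (ZMod M)ˣ, ψ u * q u := fun ψ ↦
    ModularForms.sum_eq_sum_units (m := M) (fun a ↦ ψ a * q a)
      (fun x hx ↦ by rw [MulChar.map_nonunit ψ hx, zero_mul])
  have hPζ : aeval ζ P = 0 := by
    rw [haeval, ← h, hunits]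
    exact Finset.sum_congr rfl fun u _ ↦ by rw [he u, mul_comm]
  have hmin : minpoly ℚ ζ ∣ P := minpoly.dvd ℚ ζ hPζ
  rw [← cyclotomic_eq_minpoly_rat hζprim hd0] at hmin
  -- `ζ^k` is again a primitive `d`-th root of unity, hence a root of `Φ_d`
  have hζk : IsPrimitiveRoot (ζ ^ k) d := hζprim.pow_of_coprime k hk
  have hroot : aeval (ζ ^ k) (cyclotomic d ℚ) = 0 := by
    rw [aeval_def, ← eval_map, map_cyclotomic, ← IsRoot.def, isRoot_cyclotomic_iff]
    exact hζk
  have hPk : aeval (ζ ^ k) P = 0 := by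
    obtain ⟨R, hR⟩ := hmin
    rw [hR, map_mul, hroot, zero_mul]
  rw [hunits]
  calc ∑ u : (ZMod M)ˣ, (χ ^ k) u * q u = aeval (ζ ^ k) P := by
        rw [haeval]
        refine Finset.sum_congr rfl fun u _ ↦ ?_
        rw [MulChar.pow_apply_coe, ← he u, ← pow_mul, mul_comm (e u) k, pow_mul, mul_comm]
    _ = 0 := hPk

/-! ### The Galois sub-coset family `χ · ⟨χ^r⟩` -/

section Coset

/-! The **Galois sub-coset** of a Dirichlet character `χ` is the finite family of characters
`χ^{1 + r j}`, `0 ≤ j < ord(χ^r)`, written throughout as the `Finset`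
`(Finset.range (orderOf (χ ^ r))).image fun j ↦ χ * (χ ^ r) ^ j`. When every prime factor of the
order of `χ` divides `r`, all its members are Galois conjugates `χ^k`, `(k, ord χ) = 1`, of `χ`
(Rohrlich 1984, §1, averages over the Galois orbit; this sub-coset is the part of the orbit used
here). -/

variable {M : ℕ} [DecidableEq (DirichletCharacter ℂ M)] (χ : DirichletCharacter ℂ M) (r : ℕ)

/-- Sums over the Galois sub-coset are sums over `j < ord(χ^r)`. [folklore] -/
theorem sum_galoisCoset {α : Type*} [AddCommMonoid α] (F : DirichletCharacter ℂ M → α) :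
    ∑ ψ ∈ (Finset.range (orderOf (χ ^ r))).image (fun j ↦ χ * (χ ^ r) ^ j), F ψ =
      ∑ j ∈ Finset.range (orderOf (χ ^ r)), F (χ * (χ ^ r) ^ j) := by
  rw [Finset.sum_image]
  intro i hi j hj hij
  have h := mul_left_cancel hij
  exact pow_injOn_Iio_orderOf (Finset.mem_range.mp hi) (Finset.mem_range.mp hj) h

/-- Membership in the Galois sub-coset: `ψ = χ^{1 + r j}` for some `j < ord(χ^r)`. [folklore] -/
theorem mem_galoisCoset_iff {ψ : DirichletCharacter ℂ M} :
    ψ ∈ (Finset.range (orderOf (χ ^ r))).image (fun j ↦ χ * (χ ^ r) ^ j) ↔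
      ∃ j < orderOf (χ ^ r), ψ = χ ^ (1 + r * j) := by
  simp only [Finset.mem_image, Finset.mem_range, pow_add, pow_one, pow_mul]
  constructor
  · rintro ⟨j, hj, rfl⟩; exact ⟨j, hj, rfl⟩
  · rintro ⟨j, hj, rfl⟩; exact ⟨j, hj, rfl⟩

/-- `χ` itself lies in its Galois sub-coset (`j = 0`). [folklore] -/
theorem self_mem_galoisCoset :
    χ ∈ (Finset.range (orderOf (χ ^ r))).image (fun j ↦ χ * (χ ^ r) ^ j) :=
  (mem_galoisCoset_iff χ r).mpr ⟨0, orderOf_pos _, by simp⟩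

/-- The Galois sub-coset is non-empty. [folklore] -/
theorem galoisCoset_nonempty :
    ((Finset.range (orderOf (χ ^ r))).image (fun j ↦ χ * (χ ^ r) ^ j)).Nonempty :=
  ⟨χ, self_mem_galoisCoset χ r⟩

/-- **Orthogonality along the sub-coset** (a geometric sum of roots of unity): for `z ∈ ℤ/Mℤ`,
`∑_{ψ ∈ χ⟨χ^r⟩} ψ(z) = ord(χ^r) · χ(z)` if `χ(z)^r = 1`, and `0` otherwise. [folklore] -/
theorem sum_galoisCoset_apply [NeZero M] (z : ZMod M) :
    ∑ ψ ∈ (Finset.range (orderOf (χ ^ r))).image (fun j ↦ χ * (χ ^ r) ^ j), ψ z =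
      if χ z ^ r = 1 then (orderOf (χ ^ r) : ℂ) * χ z else 0 := by
  rw [sum_galoisCoset]
  by_cases hz : IsUnit z
  · obtain ⟨u, rfl⟩ := hz
    set ω : ℂ := χ u ^ r with hω
    have hterm : ∀ j : ℕ, (χ * (χ ^ r) ^ j) (u : ZMod M) = χ u * ω ^ j := fun j ↦ by
      rw [MulChar.mul_apply, MulChar.pow_apply_coe, MulChar.pow_apply_coe, hω]
    simp_rw [hterm]
    rw [← Finset.mul_sum]
    split_ifs with h1
    · rw [h1]
      simp [mul_comm]
    · have hωT : ω ^ orderOf (χ ^ r) = 1 := by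
        have h := congr_arg (fun φ : DirichletCharacter ℂ M ↦ φ (u : ZMod M))
          (pow_orderOf_eq_one (χ ^ r))
        simpa only [MulChar.pow_apply_coe, MulChar.one_apply_coe, hω] using h
      rw [geom_sum_eq h1, hωT, sub_self, zero_div, mul_zero]
  · have h0 : χ z = 0 := MulChar.map_nonunit χ hz
    have hterm : ∀ j : ℕ, (χ * (χ ^ r) ^ j) z = 0 := fun j ↦ MulChar.map_nonunit _ hz
    simp_rw [hterm]
    rw [Finset.sum_const_zero, h0, mul_zero, ite_self]

/-- **Support of the sub-coset sum**: `∑_{ψ ∈ χ⟨χ^r⟩} ψ(z) ≠ 0` forces `z` to be a unit with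
`χ(z)^r = 1`. [folklore] -/
theorem isUnit_and_pow_eq_one_of_sum_galoisCoset_ne_zero [NeZero M] {z : ZMod M}
    (hz : ∑ ψ ∈ (Finset.range (orderOf (χ ^ r))).image (fun j ↦ χ * (χ ^ r) ^ j), ψ z ≠ 0) :
    IsUnit z ∧ χ z ^ r = 1 := by
  rw [sum_galoisCoset_apply] at hz
  split_ifs at hz with h
  · refine ⟨?_, h⟩
    by_contra hu
    rw [MulChar.map_nonunit χ hu, mul_zero] at hz
    exact hz rfl
  · exact absurd rfl hz

end Coset

/-! ### Powers coprime to the order: primitivity, parity, inverses -/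

section Powers

variable {M : ℕ} (χ : DirichletCharacter ℂ M)

/-- `χ⁻¹ = χ^{d - 1}`, `d` the order of `χ`. [folklore] -/
theorem inv_eq_pow_orderOf_sub_one : χ⁻¹ = χ ^ (orderOf χ - 1) := by
  have hd : 0 < orderOf χ := orderOf_pos χ
  symm
  apply eq_inv_of_mul_eq_one_left
  rw [← pow_succ, Nat.sub_add_cancel hd, pow_orderOf_eq_one]

/-- `d - 1` is coprime to `d = ord χ`. [folklore] -/
theorem coprime_orderOf_sub_one : (orderOf χ - 1).Coprime (orderOf χ) := by
  have hd : 0 < orderOf χ := orderOf_pos χ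
  rw [Nat.coprime_comm, Nat.Coprime]
  have h : Nat.gcd (orderOf χ) (orderOf χ - 1) ∣ orderOf χ - (orderOf χ - 1) :=
    Nat.dvd_sub (Nat.gcd_dvd_left _ _) (Nat.gcd_dvd_right _ _)
  rw [Nat.sub_sub_self hd] at h
  exact Nat.dvd_one.mp h

/-- The value `χ(-1)` is `1` or `-1`. [folklore] -/
theorem apply_neg_one_eq_one_or : χ (-1) = 1 ∨ χ (-1) = -1 := by
  have h : χ (-1) * χ (-1) = 1 := by rw [← map_mul, neg_one_mul, neg_neg, map_one]
  exact mul_self_eq_one_iff.mp h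

/-- If `χ` is odd then its order is even. [folklore] -/
theorem even_orderOf_of_apply_neg_one (hodd : χ (-1) = -1) : Even (orderOf χ) := by
  have h' : (χ (-1)) ^ orderOf χ = 1 := by
    have hu : IsUnit (-1 : ZMod M) := isUnit_one.neg
    obtain ⟨u, hu'⟩ := hu
    have := congr_arg (fun φ : DirichletCharacter ℂ M ↦ φ (u : ZMod M)) (pow_orderOf_eq_one χ)
    simp only [MulChar.pow_apply_coe, MulChar.one_apply_coe] at this
    rwa [hu'] at this
  rw [hodd] at h'
  exact (neg_one_pow_eq_one_iff_even (by norm_num)).mp h'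

/-- **Parity along coprime powers**: `χ^k(-1) = χ(-1)` for `k` coprime to the order of `χ`
(if `χ` is odd its order is even, so `k` is odd). [folklore] -/
theorem pow_apply_neg_one_of_coprime {k : ℕ} (hk : k.Coprime (orderOf χ)) :
    (χ ^ k) (-1) = χ (-1) := by
  have hu : IsUnit (-1 : ZMod M) := isUnit_one.neg
  obtain ⟨u, hu'⟩ := hu
  rw [← hu', MulChar.pow_apply_coe, hu']
  rcases apply_neg_one_eq_one_or χ with h | h
  · rw [h, one_pow]
  · rw [h]
    have hk' : Odd k := by
      have he := even_orderOf_of_apply_neg_one χ h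
      by_contra hko
      rw [Nat.not_odd_iff_even] at hko
      have h2 : 2 ∣ Nat.gcd k (orderOf χ) :=
        Nat.dvd_gcd (even_iff_two_dvd.mp hko) (even_iff_two_dvd.mp he)
      rw [hk] at h2
      omega
    exact hk'.neg_one_pow

/-- The order of `χ^k` equals the order of `χ` for `k` coprime to it. [folklore] -/
theorem orderOf_pow_of_coprime {k : ℕ} (hk : k.Coprime (orderOf χ)) :
    orderOf (χ ^ k) = orderOf χ :=
  Nat.Coprime.orderOf_pow (Nat.coprime_comm.mp hk)

/-- `(χ^k)⁻¹ = χ^{k (d-1)}` with `k (d - 1)` coprime to `d = ord χ`, for `k` coprime to `d`.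
[folklore] -/
theorem inv_pow_eq_pow_of_coprime {k : ℕ} (hk : k.Coprime (orderOf χ)) :
    (χ ^ k)⁻¹ = χ ^ (k * (orderOf χ - 1)) ∧ (k * (orderOf χ - 1)).Coprime (orderOf χ) := by
  refine ⟨?_, Nat.Coprime.mul_left hk (coprime_orderOf_sub_one χ)⟩
  rw [inv_eq_pow_orderOf_sub_one, orderOf_pow_of_coprime χ hk, ← pow_mul]

end Powers

/-! ### The kernel of reduction and primitive characters of odd prime-power conductor -/

/-- Elements of the kernel `K` of reduction `(ℤ/p^m)ˣ → (ℤ/p^{m-1})ˣ` (`m ≥ 2`) have `p`-th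
power `1`: if `x ≡ 1 (mod p^{m-1})` then `x^p ≡ 1 (mod p^m)`. [folklore] -/
theorem pow_prime_eq_one_of_mem_reductionKer {m : ℕ} (hm : 2 ≤ m) {x : (ZMod (p ^ m))ˣ}
    (hx : x ∈ WildChars.reductionKer p m) : x ^ p = 1 := by
  haveI : NeZero (p ^ m) := ⟨pow_ne_zero _ hp.out.ne_zero⟩
  have hdvd : p ^ (m - 1) ∣ p ^ m := pow_dvd_pow p (Nat.sub_le m 1)
  rw [WildChars.reductionKer, MonoidHom.mem_ker, Units.ext_iff, ZMod.unitsMap_val,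
    Units.val_one] at hx
  -- `p^(m-1) ∣ a - 1` for the representative `a` of `x`
  set a : ℤ := ((x : ZMod (p ^ m)).val : ℤ) with ha
  have h1 : ((p ^ (m - 1) : ℕ) : ℤ) ∣ a - 1 := by
    rw [← ZMod.intCast_zmod_eq_zero_iff_dvd, Int.cast_sub, Int.cast_one, ha, Int.cast_natCast,
      sub_eq_zero, ← ZMod.cast_eq_val, hx]
  have hm1 : m - 1 ≠ 0 := by omega
  have h2 : (p : ℤ) ∣ a - 1 := (dvd_pow_self (p : ℤ) hm1).trans (by exact_mod_cast h1)
  -- hence `p^m ∣ a^p - 1`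
  have h3 : (p : ℤ) ∣ ∑ i ∈ range p, a ^ i * 1 ^ (p - 1 - i) := dvd_geom_sum₂_self (by simpa using h2)
  have h4 : ((p ^ m : ℕ) : ℤ) ∣ a ^ p - 1 := by
    have hprod := mul_dvd_mul h3 h1
    rw [geom_sum₂_mul, one_pow] at hprod
    have hpm : (p : ℤ) * ((p ^ (m - 1) : ℕ) : ℤ) = ((p ^ m : ℕ) : ℤ) := by
      push_cast
      rw [← pow_succ', Nat.sub_add_cancel (by omega)]
    rwa [hpm] at hprod
  -- back to `ZMod (p^m)`
  have h5 : ((a ^ p - 1 : ℤ) : ZMod (p ^ m)) = 0 := by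
    rw [ZMod.intCast_zmod_eq_zero_iff_dvd]; exact h4
  rw [Int.cast_sub, Int.cast_pow, Int.cast_one, ha, Int.cast_natCast, ZMod.natCast_zmod_val,
    sub_eq_zero, ← Units.val_pow_eq_pow_val, Units.val_eq_one] at h5
  exact h5

/-- **Support lemma for odd `p`.** Let `χ` be a primitive Dirichlet character mod `p^m`
(`p` odd, `m ≥ 1`) and `u` a unit mod `p^m` with `χ(u)^{p(p-1)} = 1`. Then
`u^{2(p-1)} ≡ 1 (mod p^{m-1})` — indeed `u^{p-1} ≡ 1`: in the cyclic group `(ℤ/p^m)ˣ = ⟨g⟩` of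
order `p^{m-1}(p-1)`, primitivity means that `χ(g)` has order divisible by `p^{m-1}`, so
`χ(g^a)^{p(p-1)} = 1` forces `p^{m-2} ∣ a`, and `g^{p^{m-2}(p-1)} = g^{φ(p^{m-1})} ≡ 1 (mod p^{m-1})`
(Rohrlich 1984, §3, the support of the Galois average; Washington, *Cyclotomic fields*, §7.2).
[folklore] -/
theorem castHom_pow_eq_one_of_apply_pow_eq_one (hp2 : p ≠ 2) {m : ℕ} (hm : m ≠ 0)
    {χ : DirichletCharacter ℂ (p ^ m)} (hχ : χ.IsPrimitive) {u : (ZMod (p ^ m))ˣ}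
    (hu : χ u ^ (p * (p - 1)) = 1) :
    (ZMod.castHom (pow_dvd_pow p (Nat.sub_le m 1)) (ZMod (p ^ (m - 1))) (u : ZMod (p ^ m))) ^
      (2 * (p - 1)) = 1 := by
  haveI : NeZero (p ^ m) := ⟨pow_ne_zero _ hp.out.ne_zero⟩
  have hdvd : p ^ (m - 1) ∣ p ^ m := pow_dvd_pow p (Nat.sub_le m 1)
  have hp1 : 1 ≤ p := hp.out.one_le
  have hpp : Nat.Coprime p (p - 1) := (Nat.coprime_self_sub_right hp1).mpr (Nat.coprime_one_right p)
  -- the case `m = 1` is trivial (`ℤ/p^0` is the zero ring)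
  rcases Nat.lt_or_ge m 2 with hm2 | hm2
  · have hm1 : m - 1 = 0 := by omega
    haveI : Subsingleton (ZMod (p ^ (m - 1))) := by rw [hm1, pow_zero]; infer_instance
    exact Subsingleton.elim _ _
  -- `m ≥ 2`: a generator `g` of the cyclic group of units
  haveI : IsCyclic (ZMod (p ^ m))ˣ := ZMod.isCyclic_units_of_prime_pow p hp.out hp2 m
  obtain ⟨g, hg⟩ := IsCyclic.exists_monoid_generator (α := (ZMod (p ^ m))ˣ)
  have hgz : ∀ y : (ZMod (p ^ m))ˣ, y ∈ Subgroup.zpowers g := fun y ↦ by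
    obtain ⟨k, hk⟩ := (Submonoid.mem_powers_iff _ _).mp (hg y)
    exact ⟨k, by simpa using hk⟩
  set n : ℕ := p ^ (m - 1) * (p - 1) with hn
  have hcard : Fintype.card (ZMod (p ^ m))ˣ = n := by
    rw [ZMod.card_units_eq_totient, hn]
    obtain ⟨k, rfl⟩ : ∃ k, m = k + 1 := ⟨m - 1, by omega⟩
    rw [Nat.totient_prime_pow_succ hp.out, Nat.add_sub_cancel]
  have hord : orderOf g = n := by
    rw [orderOf_eq_card_of_forall_mem_zpowers hgz, Nat.card_eq_fintype_card, hcard]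
  -- `χ(g^k) = ζ^k`
  set ζ : ℂ := χ (g : ZMod (p ^ m)) with hζ
  have hpowval : ∀ k : ℕ, χ ((g ^ k : (ZMod (p ^ m))ˣ) : ZMod (p ^ m)) = ζ ^ k := fun k ↦ by
    rw [Units.val_pow_eq_pow_val, map_pow]
  -- primitivity: some `x = g^b ∈ K` has `χ(x) ≠ 1`; `x^p = 1` gives `n ∣ b p`
  obtain ⟨x, hxK, hx⟩ := (isPrimitive_iff_exists_reductionKer hm χ).mp hχ
  obtain ⟨b, rfl⟩ := (Submonoid.mem_powers_iff _ _).mp (hg x)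
  rw [hpowval] at hx
  have hxp : (g ^ b) ^ p = 1 := pow_prime_eq_one_of_mem_reductionKer hm2 hxK
  have hnb : n ∣ b * p := by
    rw [← hord]; exact orderOf_dvd_of_pow_eq_one (by rw [pow_mul]; exact hxp)
  -- the order `D` of `ζ` in `ℂ`
  have hζn : ζ ^ n = 1 := by rw [← hpowval, ← hord, pow_orderOf_eq_one, Units.val_one, map_one]
  set D := orderOf ζ with hD
  have hDn : D ∣ n := orderOf_dvd_of_pow_eq_one hζn
  have hDb : ¬ D ∣ b := fun h ↦ hx (orderOf_dvd_iff_pow_eq_one.mp h)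
  -- `p^(m-1) ∣ D`
  have hpD : p ^ (m - 1) ∣ D := by
    obtain ⟨d₁, d₂, hd₁, hd₂, hD12⟩ := Nat.dvd_mul.mp hDn
    obtain ⟨i, hi, rfl⟩ := (Nat.dvd_prime_pow hp.out).mp hd₁
    rcases Nat.lt_or_ge i (m - 1) with hlt | hge
    · -- then `D ∣ p^(m-2) (p-1)`, which divides `b` — contradiction
      exfalso
      apply hDb
      have hD' : D ∣ p ^ (m - 2) * (p - 1) := by
        rw [← hD12]
        exact mul_dvd_mul (pow_dvd_pow p (by omega)) hd₂
      refine hD'.trans ?_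
      -- `n = p^(m-2)(p-1) · p ∣ b p`
      have hn' : n = p ^ (m - 2) * (p - 1) * p := by
        rw [hn, mul_right_comm, ← pow_succ, show m - 2 + 1 = m - 1 by omega]
      rw [hn'] at hnb
      exact Nat.dvd_of_mul_dvd_mul_right hp.out.pos hnb
    · have : i = m - 1 := le_antisymm hi hge
      subst this
      exact ⟨d₂, hD12.symm⟩
  -- `u = g^a` with `p^(m-2) ∣ a`
  obtain ⟨a, rfl⟩ := (Submonoid.mem_powers_iff _ _).mp (hg u)
  rw [hpowval, ← pow_mul] at hu
  have hDa : D ∣ a * (p * (p - 1)) := orderOf_dvd_iff_pow_eq_one.mpr hu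
  have hpa : p ^ (m - 2) ∣ a := by
    have h1 : p ^ (m - 1) ∣ a * (p * (p - 1)) := hpD.trans hDa
    have h2 : p ^ (m - 2) * p ∣ a * (p - 1) * p := by
      rw [← pow_succ, show m - 2 + 1 = m - 1 by omega, mul_assoc, mul_comm (p - 1) p]
      exact h1
    have h3 : p ^ (m - 2) ∣ a * (p - 1) := Nat.dvd_of_mul_dvd_mul_right hp.out.pos h2
    exact (Nat.Coprime.pow_left (m - 2) hpp).dvd_of_dvd_mul_right h3
  obtain ⟨a', rfl⟩ := hpa
  -- `g^(φ(p^(m-1))) ≡ 1 (mod p^(m-1))`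
  have htot : Nat.totient (p ^ (m - 1)) = p ^ (m - 2) * (p - 1) := by
    obtain ⟨k, hk⟩ : ∃ k, m - 1 = k + 1 := ⟨m - 2, by omega⟩
    rw [hk, Nat.totient_prime_pow_succ hp.out, show m - 2 = k by omega]
  haveI : NeZero (p ^ (m - 1)) := ⟨pow_ne_zero _ hp.out.ne_zero⟩
  have hred : ZMod.unitsMap hdvd ((g ^ (p ^ (m - 2) * a')) ^ (p - 1)) = 1 := by
    rw [← pow_mul, show p ^ (m - 2) * a' * (p - 1) = Nat.totient (p ^ (m - 1)) * a' by
      rw [htot]; ring, pow_mul, map_pow, map_pow, ZMod.pow_totient, one_pow]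
  rw [Units.ext_iff, ZMod.unitsMap_val, Units.val_one, Units.val_pow_eq_pow_val,
    ZMod.cast_pow hdvd] at hred
  rw [ZMod.castHom_apply, mul_comm 2, pow_mul, hred, one_pow]

/-! ### The support lemma at `p = 2` -/

/-- Squares of units mod `8` are `1`. [folklore] -/
theorem units_sq_eq_one_mod_eight : ∀ w : (ZMod 8)ˣ, w ^ 2 = 1 := by decide

/-- Elements of the kernel of reduction `(ℤ/2^m)ˣ → (ℤ/2^{m-1})ˣ` (`m ≥ 2`) are `1` and
`1 + 2^{m-1}`. [folklore] -/
theorem val_eq_of_mem_reductionKer_two {m : ℕ} (hm : 2 ≤ m) {x : (ZMod (2 ^ m))ˣ}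
    (hx : x ∈ WildChars.reductionKer 2 m) :
    (x : ZMod (2 ^ m)) = 1 ∨ (x : ZMod (2 ^ m)) = 1 + ((2 ^ (m - 1) : ℕ) : ZMod (2 ^ m)) := by
  haveI : NeZero (2 ^ m) := ⟨pow_ne_zero _ two_ne_zero⟩
  haveI : NeZero (2 ^ (m - 1)) := ⟨pow_ne_zero _ two_ne_zero⟩
  have hdvd : 2 ^ (m - 1) ∣ 2 ^ m := pow_dvd_pow 2 (Nat.sub_le m 1)
  rw [WildChars.reductionKer, MonoidHom.mem_ker, Units.ext_iff, ZMod.unitsMap_val,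
    Units.val_one, ZMod.cast_eq_val] at hx
  set Q : ℕ := 2 ^ (m - 1) with hQ
  set a : ℕ := (x : ZMod (2 ^ m)).val with ha
  have hmod : a % Q = 1 := by
    have h1 : ((a : ℕ) : ZMod Q) = ((1 : ℕ) : ZMod Q) := by rw [Nat.cast_one]; exact hx
    rw [ZMod.natCast_eq_natCast_iff'] at h1
    rw [h1, Nat.mod_eq_of_lt]
    calc 1 < 2 ^ 1 := by norm_num
      _ ≤ Q := Nat.pow_le_pow_right (by norm_num) (by omega)
  have hlt : a < Q * 2 := by
    have : a < 2 ^ m := ZMod.val_lt _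
    rwa [hQ, ← pow_succ, Nat.sub_add_cancel (by omega)]
  have hdiv : a / Q < 2 := Nat.div_lt_of_lt_mul hlt
  have hdecomp := Nat.div_add_mod a Q
  have hx' : (x : ZMod (2 ^ m)) = ((a : ℕ) : ZMod (2 ^ m)) := by rw [ha, ZMod.natCast_zmod_val]
  interval_cases h : a / Q
  · left
    rw [hx', show a = 1 by omega, Nat.cast_one]
  · right
    rw [hx', show a = 1 + Q by omega]
    push_cast
    rfl

/-- **Support lemma for `p = 2`.** Let `χ` be a primitive Dirichlet character mod `2^m` (`m ≥ 1`)
and `u` a unit mod `2^m` with `χ(u)² = 1`. Then `u² ≡ 1 (mod 2^{m-1})` — indeed `u² = 1` for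
`m ≥ 4`: otherwise the element of order `2` in `⟨u²⟩ ⊆ ker χ` is a square `≡ 1 (mod 8)` among the
four square roots of `1`, i.e. `1 + 2^{m-1}`, the generator of the kernel of reduction mod
`2^{m-1}`, on which a primitive `χ` is non-trivial (Washington, *Cyclotomic fields*, §7.2).
[folklore] -/
theorem castHom_sq_eq_one_of_apply_sq_eq_one {m : ℕ} (hm : m ≠ 0)
    {χ : DirichletCharacter ℂ (2 ^ m)} (hχ : χ.IsPrimitive) {u : (ZMod (2 ^ m))ˣ}
    (hu : χ u ^ 2 = 1) :
    (ZMod.castHom (pow_dvd_pow 2 (Nat.sub_le m 1)) (ZMod (2 ^ (m - 1))) (u : ZMod (2 ^ m))) ^ 2 = 1 := by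
  haveI : Fact (Nat.Prime 2) := ⟨Nat.prime_two⟩
  haveI : NeZero (2 ^ m) := ⟨pow_ne_zero _ two_ne_zero⟩
  haveI : NeZero (2 ^ (m - 1)) := ⟨pow_ne_zero _ two_ne_zero⟩
  have hdvd : 2 ^ (m - 1) ∣ 2 ^ m := pow_dvd_pow 2 (Nat.sub_le m 1)
  -- the statement in terms of the unit `ū = u mod 2^(m-1)`
  suffices h : ZMod.unitsMap hdvd u ^ 2 = 1 by
    rw [Units.ext_iff, Units.val_pow_eq_pow_val, ZMod.unitsMap_val, Units.val_one] at h
    rw [ZMod.castHom_apply]; exact h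
  -- small `m`: every unit mod `1`, `2`, `4` squares to `1`
  have hm1 : 1 ≤ m := Nat.pos_of_ne_zero hm
  rcases Nat.lt_or_ge m 4 with hm4 | hm4
  · generalize ZMod.unitsMap hdvd u = w
    interval_cases m
    · revert w; decide
    · revert w; decide
    · revert w; decide
  -- `m ≥ 4`: `v = u²` is trivial
  set v : (ZMod (2 ^ m))ˣ := u ^ 2 with hv
  have hχv : χ (v : ZMod (2 ^ m)) = 1 := by rw [hv, Units.val_pow_eq_pow_val, map_pow, hu]
  suffices hv1 : v = 1 by
    rw [← map_pow, ← hv, hv1, map_one]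
  by_contra hv1
  -- the order of `v` is `2^j`, `j ≥ 1`
  have hcard : Fintype.card (ZMod (2 ^ m))ˣ = 2 ^ (m - 1) := by
    rw [ZMod.card_units_eq_totient]
    obtain ⟨k, rfl⟩ : ∃ k, m = k + 1 := ⟨m - 1, by omega⟩
    rw [Nat.totient_prime_pow_succ Nat.prime_two, Nat.add_sub_cancel]; simp
  have hord : orderOf v ∣ 2 ^ (m - 1) := by
    rw [← hcard]; exact orderOf_dvd_card
  obtain ⟨j, hjle, hj⟩ := (Nat.dvd_prime_pow Nat.prime_two).mp hord
  have hj0 : j ≠ 0 := by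
    rintro rfl
    rw [pow_zero, orderOf_eq_one_iff] at hj
    exact hv1 hj
  -- `k = v^(2^(j-1))` has `k² = 1`, `k ≠ 1`, and is a square
  set k : (ZMod (2 ^ m))ˣ := v ^ (2 ^ (j - 1)) with hk
  have hk2 : k ^ 2 = 1 := by
    rw [hk, ← pow_mul, ← pow_succ, Nat.sub_add_cancel (Nat.pos_of_ne_zero hj0), ← hj,
      pow_orderOf_eq_one]
  have hk1 : k ≠ 1 := by
    rw [hk]
    refine pow_ne_one_of_lt_orderOf (pow_ne_zero _ two_ne_zero) ?_
    rw [hj]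
    exact Nat.pow_lt_pow_right (by norm_num) (by omega)
  have hχk : χ (k : ZMod (2 ^ m)) = 1 := by
    rw [hk, Units.val_pow_eq_pow_val, map_pow, hχv, one_pow]
  have hksq : k = (u ^ (2 ^ (j - 1))) ^ 2 := by
    rw [hk, hv, ← pow_mul, ← pow_mul, mul_comm]
  -- `k ≡ 1 (mod 8)`
  have h8dvd : 8 ∣ 2 ^ m := by
    rw [show (8 : ℕ) = 2 ^ 3 by norm_num]; exact pow_dvd_pow 2 (by omega)
  have hk8 : ZMod.castHom h8dvd (ZMod 8) (k : ZMod (2 ^ m)) = 1 := by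
    have h := units_sq_eq_one_mod_eight (ZMod.unitsMap h8dvd (u ^ (2 ^ (j - 1))))
    rw [← map_pow, ← hksq, Units.ext_iff, ZMod.unitsMap_val, Units.val_one] at h
    rw [ZMod.castHom_apply]; exact h
  -- the four square roots of `1`
  have hsq : (k : ZMod (2 ^ m)) ^ 2 = 1 ^ 2 := by
    rw [one_pow, ← Units.val_pow_eq_pow_val, hk2, Units.val_one]
  have h2m1 : (((2 ^ (m - 1) : ℕ) : ZMod (2 ^ m)) : ZMod (2 ^ m)).cast = (0 : ZMod 8) := by
    rw [ZMod.cast_natCast h8dvd, ZMod.natCast_eq_zero_iff]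
    rw [show (8 : ℕ) = 2 ^ 3 by norm_num]; exact pow_dvd_pow 2 (by omega)
  have hneg1 : ((-1 : ZMod (2 ^ m))).cast = (-1 : ZMod 8) := by
    rw [ZMod.cast_neg h8dvd, ZMod.cast_one h8dvd]
  rcases LFunctions.mem_of_sq_eq_sq_two hm isUnit_one hsq with h | h | h | h
  · exact hk1 (Units.val_eq_one.mp h)
  · rw [ZMod.castHom_apply, h, hneg1] at hk8
    exact absurd hk8 (by decide)
  · -- `k = 1 + 2^(m-1)`: then `χ` is trivial on the kernel of reduction, contradiction
    obtain ⟨x, hxK, hx⟩ := (isPrimitive_iff_exists_reductionKer hm χ).mp hχ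
    apply hx
    rcases val_eq_of_mem_reductionKer_two (by omega : 2 ≤ m) hxK with hx1 | hx1
    · rw [hx1, map_one]
    · rw [hx1, ← h, hχk]
  · rw [ZMod.castHom_apply, h, ZMod.cast_add h8dvd, hneg1, h2m1, add_zero] at hk8
    exact absurd hk8 (by decide)

/-- **Support lemma, all primes.** For a primitive character `χ` mod `p^m` (`m ≥ 1`) and a unit
`u` with `χ(u)^{p(p-1)} = 1`: `u^{2(p-1)} ≡ 1 (mod p^{m-1})` (`castHom_pow_eq_one_of_apply_pow_eq_one`
for odd `p`, `castHom_sq_eq_one_of_apply_sq_eq_one` for `p = 2`). [folklore] -/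
theorem castHom_pow_eq_one_of_apply_pow_eq_one_prime {m : ℕ} (hm : m ≠ 0)
    {χ : DirichletCharacter ℂ (p ^ m)} (hχ : χ.IsPrimitive) {u : (ZMod (p ^ m))ˣ}
    (hu : χ u ^ (p * (p - 1)) = 1) :
    (ZMod.castHom (pow_dvd_pow p (Nat.sub_le m 1)) (ZMod (p ^ (m - 1))) (u : ZMod (p ^ m))) ^
      (2 * (p - 1)) = 1 := by
  by_cases hp2 : p = 2
  · subst hp2
    exact castHom_sq_eq_one_of_apply_sq_eq_one hm hχ (by simpa using hu)
  · exact castHom_pow_eq_one_of_apply_pow_eq_one hp2 hm hχ hu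

/-! ### Families of characters mod `p^m` with sparse support -/

section Family

/-- `|∑_{ψ ∈ X} ψ(x)| ≤ #X` for any finite family of Dirichlet characters. [folklore] -/
theorem norm_sum_apply_le_card {M : ℕ} [NeZero M] (X : Finset (DirichletCharacter ℂ M)) (x : ZMod M) :
    ‖∑ χ ∈ X, χ x‖ ≤ X.card := by
  refine (norm_sum_le _ _).trans ?_
  calc ∑ χ ∈ X, ‖χ x‖ ≤ ∑ χ ∈ X, (1 : ℝ) := Finset.sum_le_sum fun χ _ ↦ χ.norm_le_one x
    _ = X.card := by simp

/-- A sum of character values over any family vanishes at non-units. [folklore] -/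
theorem sum_apply_eq_zero_of_not_isUnit {M : ℕ} [NeZero M] (X : Finset (DirichletCharacter ℂ M))
    {x : ZMod M} (hx : ¬ IsUnit x) : ∑ χ ∈ X, χ x = 0 :=
  Finset.sum_eq_zero fun χ _ ↦ MulChar.map_nonunit χ hx

/-- **The support of `∑_{χ ∈ X} χ` has at most `4p²` elements** whenever it is contained in
`{z : z^{2(p-1)} ≡ 1 (mod p^{m-1})}` (as for the wild family, `card_support_sum_wildChars_le`).
[folklore] -/
theorem card_support_sum_le {m : ℕ} [NeZero (p ^ m)] (hm : m ≠ 0)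
    (X : Finset (DirichletCharacter ℂ (p ^ m)))
    (hsupp : ∀ z : ZMod (p ^ m), ∑ χ ∈ X, χ z ≠ 0 →
      (ZMod.castHom (pow_dvd_pow p (Nat.sub_le m 1)) (ZMod (p ^ (m - 1))) z) ^ (2 * (p - 1)) = 1) :
    (Finset.univ.filter fun z : ZMod (p ^ m) ↦ ∑ χ ∈ X, χ z ≠ 0).card ≤ 4 * p * p := by
  classical
  set Q : ZMod (p ^ (m - 1)) → Prop := fun r ↦ r ^ (2 * (p - 1)) = 1 with hQ
  calc _ ≤ (Finset.univ.filter fun z : ZMod (p ^ m) ↦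
          Q (ZMod.castHom (pow_dvd_pow p (Nat.sub_le m 1)) (ZMod (p ^ (m - 1))) z)).card :=
        Finset.card_le_card fun z hz ↦ by
          rw [Finset.mem_filter] at hz ⊢
          exact ⟨hz.1, hsupp z hz.2⟩
    _ = ((Finset.range (p ^ m)).filter fun u : ℕ ↦ Q (u : ZMod (p ^ (m - 1)))).card := by
        rw [Finset.card_filter, Finset.card_filter, LFunctions.sum_zmod_eq_sum_range]
        refine Finset.sum_congr rfl fun n _ ↦ ?_
        rw [ZMod.castHom_apply, ZMod.cast_natCast (pow_dvd_pow p (Nat.sub_le m 1))]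
    _ = p ^ (m - (m - 1)) * (Finset.univ.filter Q).card :=
        LFunctions.card_filter_range_pow_eq (Nat.sub_le m 1) Q
    _ ≤ p ^ 1 * (4 * p) := by
        rw [show m - (m - 1) = 1 by omega]
        exact Nat.mul_le_mul_left _ (card_filter_pow_eq_one_le (m - 1))
    _ = 4 * p * p := by ring

omit hp in
/-- **The Gauss-sum average over a family is a short sum of Kloosterman sums.** For a unit `y`
mod `p^m` and any finite family `X` of Dirichlet characters mod `p^m`:
`∑_{χ ∈ X} χ(y) τ(χ)² = ∑_{h} A(h) · S(1, y⁻¹h; p^m)`, `A(h) = ∑_{χ ∈ X} χ(h)`, `h` over the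
support of `A` (the computation of `sum_wildChars_mul_gaussSum_sq_eq` for a general family).
[folklore] -/
theorem sum_mul_gaussSum_sq_eq_sum_kloosterman {m : ℕ} [NeZero (p ^ m)]
    (X : Finset (DirichletCharacter ℂ (p ^ m))) {y : ZMod (p ^ m)} (hy : IsUnit y) :
    ∑ χ ∈ X, χ y * gaussSum χ (ZMod.stdAddChar (N := p ^ m)) ^ 2 =
      ∑ h ∈ Finset.univ.filter (fun z : ZMod (p ^ m) ↦ ∑ χ ∈ X, χ z ≠ 0),
        (∑ χ ∈ X, χ h) * LFunctions.kloostermanSum (p ^ m) 1 (h * y⁻¹) := by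
  classical
  set A : ZMod (p ^ m) → ℂ := fun z ↦ ∑ χ ∈ X, χ z with hA
  set e : ZMod (p ^ m) → ℂ := fun a ↦ (ZMod.stdAddChar a : ℂ) with he
  -- Step 1: expand the square and move the character sum inside
  have h1 : ∑ χ ∈ X, χ y * gaussSum χ (ZMod.stdAddChar (N := p ^ m)) ^ 2 =
      ∑ a : ZMod (p ^ m), ∑ b : ZMod (p ^ m), e a * e b * A (y * a * b) := by
    have : ∀ χ ∈ X, χ y * gaussSum χ (ZMod.stdAddChar (N := p ^ m)) ^ 2 =
        ∑ a : ZMod (p ^ m), ∑ b : ZMod (p ^ m), e a * e b * χ (y * a * b) := by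
      intro χ _
      rw [gaussSum, sq, Finset.sum_mul_sum, Finset.mul_sum]
      refine Finset.sum_congr rfl fun a _ ↦ ?_
      rw [Finset.mul_sum]
      refine Finset.sum_congr rfl fun b _ ↦ ?_
      rw [map_mul, map_mul, he]
      ring
    rw [Finset.sum_congr rfl this, Finset.sum_comm]
    refine Finset.sum_congr rfl fun a _ ↦ ?_
    rw [Finset.sum_comm]
    refine Finset.sum_congr rfl fun b _ ↦ ?_
    rw [hA, Finset.mul_sum]
  -- Step 2: the support of `A`
  have h2 : ∀ z : ZMod (p ^ m), A z = ∑ h ∈ Finset.univ.filter (fun z : ZMod (p ^ m) ↦ A z ≠ 0),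
      if z = h then A h else 0 := by
    intro z
    rw [Finset.sum_ite_eq]
    by_cases hz : A z = 0
    · rw [if_neg (by simp [hz]), hz]
    · rw [if_pos (by simp [hz])]
  have hyinv : y⁻¹ * y = 1 := ZMod.inv_mul_of_unit y hy
  have hyy : y * y⁻¹ = 1 := ZMod.mul_inv_of_unit y hy
  -- Step 3: for `h` in the support, `∑_{a b} [y a b = h] e(a) e(b) = S(1, h y⁻¹)`
  have h3 : ∀ h : ZMod (p ^ m), A h ≠ 0 →
      ∑ a : ZMod (p ^ m), ∑ b : ZMod (p ^ m), (if y * a * b = h then e a * e b else 0) =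
        LFunctions.kloostermanSum (p ^ m) 1 (h * y⁻¹) := by
    intro h hh
    have hhu : IsUnit h := by
      by_contra hnu
      exact hh (sum_apply_eq_zero_of_not_isUnit X hnu)
    have hyu : IsUnit y⁻¹ := by
      rw [← IsUnit.unit_spec hy, ZMod.inv_coe_unit]; exact Units.isUnit _
    have hcu : IsUnit (h * y⁻¹) := hhu.mul hyu
    rw [LFunctions.kloostermanSum]
    refine Finset.sum_congr rfl fun a _ ↦ ?_
    have hiff : ∀ b : ZMod (p ^ m), (y * a * b = h) ↔ (a * b = h * y⁻¹) := by
      intro b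
      constructor
      · intro hab; rw [← hab]; linear_combination (-(a * b)) * hyinv
      · intro hab
        calc y * a * b = y * (a * b) := by ring
          _ = h := by rw [hab]; linear_combination h * hyy
    simp_rw [hiff]
    rw [sum_ite_mul_eq hcu (fun b ↦ e a * e b) a]
    by_cases ha : IsUnit a
    · rw [if_pos ha, if_pos ha, he]
      dsimp only
      rw [← AddChar.map_add_eq_mul, one_mul]
    · rw [if_neg ha, if_neg ha]
  -- assemble
  rw [h1]
  calc ∑ a : ZMod (p ^ m), ∑ b : ZMod (p ^ m), e a * e b * A (y * a * b)
      = ∑ a : ZMod (p ^ m), ∑ b : ZMod (p ^ m),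
          ∑ h ∈ Finset.univ.filter (fun z : ZMod (p ^ m) ↦ A z ≠ 0),
            A h * (if y * a * b = h then e a * e b else 0) := by
        refine Finset.sum_congr rfl fun a _ ↦ Finset.sum_congr rfl fun b _ ↦ ?_
        rw [h2 (y * a * b), Finset.mul_sum]
        refine Finset.sum_congr rfl fun h _ ↦ ?_
        split_ifs <;> ring
    _ = ∑ a : ZMod (p ^ m), ∑ h ∈ Finset.univ.filter (fun z : ZMod (p ^ m) ↦ A z ≠ 0),
          ∑ b : ZMod (p ^ m), A h * (if y * a * b = h then e a * e b else 0) :=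
        Finset.sum_congr rfl fun a _ ↦ Finset.sum_comm
    _ = ∑ h ∈ Finset.univ.filter (fun z : ZMod (p ^ m) ↦ A z ≠ 0), ∑ a : ZMod (p ^ m),
          ∑ b : ZMod (p ^ m), A h * (if y * a * b = h then e a * e b else 0) := Finset.sum_comm
    _ = ∑ h ∈ Finset.univ.filter (fun z : ZMod (p ^ m) ↦ A z ≠ 0),
          A h * ∑ a : ZMod (p ^ m), ∑ b : ZMod (p ^ m), (if y * a * b = h then e a * e b else 0) := by
        refine Finset.sum_congr rfl fun h _ ↦ ?_
        rw [Finset.mul_sum]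
        exact Finset.sum_congr rfl fun a _ ↦ by rw [Finset.mul_sum]
    _ = _ := by
        refine Finset.sum_congr rfl fun h hh ↦ ?_
        rw [h3 h (Finset.mem_filter.mp hh).2]

/-- **The Gauss-sum average bound for a sparse family.** For a unit `y` mod `p^m`, `m ≥ 1`, and a
family `X` whose character sum is supported in `{z : z^{2(p-1)} ≡ 1 (mod p^{m-1})}`:
`‖∑_{χ ∈ X} χ(y) τ(χ)²‖ ≤ 4p² · #X · 4 p^{⌈m/2⌉}` (as `norm_sum_wildChars_mul_gaussSum_sq_le`, via
the elementary Kloosterman bound `norm_kloostermanSum_one_le`; Rohrlich 1984, §3–4 treats the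
Galois average by explicit Gauss sums). [folklore] -/
theorem norm_sum_mul_gaussSum_sq_le_of_support {m : ℕ} [NeZero (p ^ m)] (hm : m ≠ 0)
    (X : Finset (DirichletCharacter ℂ (p ^ m)))
    (hsupp : ∀ z : ZMod (p ^ m), ∑ χ ∈ X, χ z ≠ 0 →
      (ZMod.castHom (pow_dvd_pow p (Nat.sub_le m 1)) (ZMod (p ^ (m - 1))) z) ^ (2 * (p - 1)) = 1)
    {y : ZMod (p ^ m)} (hy : IsUnit y) :
    ‖∑ χ ∈ X, χ y * gaussSum χ (ZMod.stdAddChar (N := p ^ m)) ^ 2‖ ≤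
      (4 * p * p : ℕ) * (X.card * (4 * (p : ℝ) ^ (m - m / 2))) := by
  classical
  rw [sum_mul_gaussSum_sq_eq_sum_kloosterman X hy]
  refine (norm_sum_le _ _).trans ?_
  calc ∑ h ∈ Finset.univ.filter (fun z : ZMod (p ^ m) ↦ ∑ χ ∈ X, χ z ≠ 0),
        ‖(∑ χ ∈ X, χ h) * LFunctions.kloostermanSum (p ^ m) 1 (h * y⁻¹)‖
      ≤ ∑ h ∈ Finset.univ.filter (fun z : ZMod (p ^ m) ↦ ∑ χ ∈ X, χ z ≠ 0),
          X.card * (4 * (p : ℝ) ^ (m - m / 2)) := by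
        refine Finset.sum_le_sum fun h _ ↦ ?_
        rw [norm_mul]
        exact mul_le_mul (norm_sum_apply_le_card X h) (LFunctions.norm_kloostermanSum_one_le m _)
          (norm_nonneg _) (Nat.cast_nonneg _)
    _ ≤ _ := by
        rw [Finset.sum_const, nsmul_eq_mul]
        gcongr
        exact_mod_cast card_support_sum_le hm X hsupp

end Family

/-! ### The first moment over a family of primitive characters of constant parity -/

section Moment

open ModularForms UpperHalfPlane

variable {N : ℕ} [NeZero N] (f : CuspForm (CongruenceSubgroup.Gamma0 N) 2)

/-- **The first-moment identity over a family.** Let `f, g ∈ S_2(Γ₀(N))` with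
`f(-1/(Nτ)) = N τ² g(τ)` (a Fricke pair), `p ∤ N`, `m ≥ 1`, `Y > 0`, `Y' = 1/(N p^{2m} Y)`, and let
`X` be a finite family of *primitive* characters mod `p^m` of constant parity `χ(-1) = ε`. Summing
the two-sided series (`twistedSymbolSum_inv_eq_dampedTwist_of_isFrickePair`) against the weights
`τ(χ)/p^m` (`τ(χ)τ(χ̄) = χ(-1) p^m`, `gaussSum_mul_gaussSum_inv`):
`∑_{χ ∈ X} (τ(χ)/p^m) ∑_a χ(a){∞, a/p^m}_f = ε · (D_f(A, Y) - (1/p^m) D_g(B, Y'))` with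
`A(n) = ∑_{χ} χ(n)` and `B(n) = ∑_{χ} χ(N) τ(χ)² χ̄(n)` (Rohrlich 1984, §2–3, for the Galois
average; `sum_wildChars_twistedSymbolSum_eq` is the case of the wild family, `ε = 1`). [folklore] -/
theorem sum_family_twistedSymbolSum_eq {g : CuspForm (CongruenceSubgroup.Gamma0 N) 2}
    (hW : IsFrickePair N f g) (hpN : ¬ p ∣ N) {m : ℕ} [NeZero (p ^ m)]
    (X : Finset (DirichletCharacter ℂ (p ^ m))) {ε : ℂ}
    (hX : ∀ χ ∈ X, χ.IsPrimitive ∧ χ (-1) = ε) {Y : ℝ} (hY : 0 < Y) :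
    ∑ χ ∈ X, gaussSum χ (ZMod.stdAddChar (N := p ^ m)) / (p ^ m : ℂ) *
        twistedSymbolSum f χ⁻¹ =
      ε * (dampedTwist f (fun n ↦ ∑ χ ∈ X, χ n) Y -
        1 / (p ^ m : ℂ) * dampedTwist g (fun n ↦ ∑ χ ∈ X,
          χ N * gaussSum χ (ZMod.stdAddChar (N := p ^ m)) ^ 2 * χ⁻¹ n)
            (1 / ((N : ℝ) * (p ^ m : ℕ) ^ 2 * Y))) := by
  have hp' : p.Prime := Fact.out
  have hmN : (p ^ m).Coprime N := Nat.Coprime.pow_left _ ((Nat.Prime.coprime_iff_not_dvd hp').mpr hpN)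
  have hY' : 0 < 1 / ((N : ℝ) * (p ^ m : ℕ) ^ 2 * Y) := by
    have : (0 : ℝ) < N := Nat.cast_pos.mpr (NeZero.pos N)
    have : (0 : ℝ) < (p ^ m : ℕ) := Nat.cast_pos.mpr (NeZero.pos _)
    positivity
  have hpm : ((p ^ m : ℕ) : ℂ) ≠ 0 := Nat.cast_ne_zero.mpr (NeZero.ne _)
  -- termwise
  have hterm : ∀ χ ∈ X,
      gaussSum χ (ZMod.stdAddChar (N := p ^ m)) / (p ^ m : ℂ) * twistedSymbolSum f χ⁻¹ =
        ε * ((1 : ℂ) * dampedTwist f (fun n ↦ χ n) Y) -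
          ε * (1 / (p ^ m : ℂ) * ((χ N * gaussSum χ (ZMod.stdAddChar (N := p ^ m)) ^ 2) *
            dampedTwist g (fun n ↦ χ⁻¹ n) (1 / ((N : ℝ) * (p ^ m : ℕ) ^ 2 * Y)))) := by
    intro χ hχ
    obtain ⟨hprim, hpar⟩ := hX χ hχ
    have h := twistedSymbolSum_inv_eq_dampedTwist_of_isFrickePair f g hW hmN hprim hY
    have hgg := Literature.NumberTheory.Sieve.LargeSieve.gaussSum_mul_gaussSum_inv hprim
    have h1 : χ⁻¹ (-1) = ε := by
      rw [MulChar.inv_apply_eq_inv', hpar]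
      rcases apply_neg_one_eq_one_or χ with h' | h'
      · rw [← hpar, h', inv_one]
      · rw [← hpar, h', inv_neg, inv_one]
    rw [hpar] at hgg
    push_cast at h hgg ⊢
    rw [h, h1]
    have hpm' : (p : ℂ) ^ m ≠ 0 := by exact_mod_cast hpm
    field_simp
    linear_combination dampedTwist f (fun n ↦ χ n) Y * hgg
  rw [Finset.sum_congr rfl hterm, Finset.sum_sub_distrib]
  have hA : ∑ χ ∈ X, ε * ((1 : ℂ) * dampedTwist f (fun n ↦ χ n) Y) =
      ε * dampedTwist f (fun n ↦ ∑ χ ∈ X, χ n) Y := by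
    rw [← Finset.mul_sum, sum_mul_dampedTwist f X (fun _ ↦ (1 : ℂ))
      (fun (χ : DirichletCharacter ℂ (p ^ m)) (n : ℕ) ↦ χ n) (B := 1)
      (fun χ n ↦ DirichletCharacter.norm_le_one χ _) hY]
    simp
  have hB : ∑ χ ∈ X, ε * (1 / (p ^ m : ℂ) * ((χ N * gaussSum χ (ZMod.stdAddChar (N := p ^ m)) ^ 2) *
      dampedTwist g (fun n ↦ χ⁻¹ n) (1 / ((N : ℝ) * (p ^ m : ℕ) ^ 2 * Y)))) =
      ε * (1 / (p ^ m : ℂ) * dampedTwist g (fun n ↦ ∑ χ ∈ X,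
          χ N * gaussSum χ (ZMod.stdAddChar (N := p ^ m)) ^ 2 * χ⁻¹ n)
            (1 / ((N : ℝ) * (p ^ m : ℕ) ^ 2 * Y))) := by
    rw [← Finset.mul_sum, ← Finset.mul_sum, sum_mul_dampedTwist g X _
      (fun (χ : DirichletCharacter ℂ (p ^ m)) (n : ℕ) ↦ χ⁻¹ n) (B := 1)
      (fun χ n ↦ DirichletCharacter.norm_le_one χ⁻¹ _) hY']
  rw [hA, hB, mul_sub]

end Moment

/-! ### The two error terms for a sparse family -/

section Errors

open ModularForms UpperHalfPlane

variable {N : ℕ} [NeZero N] (f : CuspForm (CongruenceSubgroup.Gamma0 N) 2)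

omit [NeZero N] in
/-- **The main-term error for a sparse family.** For `f` with `a₁ = 1`, `|aₙ| ≤ C n^θ`
(`0 < θ ≤ 1`), `m ≥ 1`, `Y > 0`, `q = p^{m-1}`, and a family `X` of characters mod `p^m` whose
character sum `A = ∑_{χ ∈ X} χ` is supported in `{z : z^{2(p-1)} ≡ 1 (mod q)}`:
`‖D_f(A, Y) - #X e^{-2πY}‖ ≤ #X · C · 4p · (q^{(θ-1)/(2(p-1))} + q^{θ-1}(1 + Γ(θ)(2πYq)^{-θ}))`
(the estimate `norm_dampedTwist_sum_wildChars_sub_le` of the wild family, verbatim for `X`).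
[folklore] -/
theorem norm_dampedTwist_sum_sub_le_of_support {m : ℕ} [NeZero (p ^ m)]
    (X : Finset (DirichletCharacter ℂ (p ^ m)))
    (hsupp : ∀ z : ZMod (p ^ m), ∑ χ ∈ X, χ z ≠ 0 →
      (ZMod.castHom (pow_dvd_pow p (Nat.sub_le m 1)) (ZMod (p ^ (m - 1))) z) ^ (2 * (p - 1)) = 1)
    {C θ : ℝ} (hC : 0 ≤ C) (hθ : 0 < θ) (hθ1 : θ ≤ 1)
    (ha : ∀ n : ℕ, ‖cuspCoeff f n‖ ≤ C * (n : ℝ) ^ θ) (h1 : cuspCoeff f 1 = 1) {Y : ℝ} (hY : 0 < Y) :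
    ‖dampedTwist f (fun n ↦ ∑ χ ∈ X, χ n) Y - X.card * (Real.exp (-(2 * Real.pi) * Y) : ℝ)‖ ≤
      X.card * (C * ((4 * p : ℕ) *
        ((((p ^ (m - 1) : ℕ) : ℝ) ^ (1 / (2 * (p - 1) : ℝ))) ^ (θ - 1) +
          ((p ^ (m - 1) : ℕ) : ℝ) ^ (θ - 1) *
            (1 + Real.Gamma θ * (2 * Real.pi * Y * (p ^ (m - 1) : ℕ)) ^ (-θ))))) := by
  classical
  set q : ℕ := p ^ (m - 1) with hq
  have hq0 : 0 < q := pow_pos hp.out.pos _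
  haveI : NeZero q := ⟨hq0.ne'⟩
  set A : ℕ → ℂ := fun n ↦ ∑ χ ∈ X, χ n with hA
  set c : ℝ := 2 * Real.pi * Y with hc
  have hcpos : 0 < c := by positivity
  set term : ℕ → ℂ := fun n ↦ A n * cuspCoeff f n * (Real.exp (-(2 * Real.pi * n) * Y) / n : ℝ)
    with hterm
  have hAle : ∀ n : ℕ, ‖A n‖ ≤ X.card := fun n ↦ norm_sum_apply_le_card X _
  have hsum : Summable term := summable_dampedTwist f hAle hY
  -- the term `n = 1`
  have hA1 : A 1 = X.card := by simp [hA]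
  have ht1 : term 1 = X.card * (Real.exp (-(2 * Real.pi) * Y) : ℝ) := by
    simp only [hterm, hA1, h1, Nat.cast_one, mul_one, div_one]
  have hsplit : dampedTwist f (fun n ↦ ∑ χ ∈ X, χ n) Y -
      X.card * (Real.exp (-(2 * Real.pi) * Y) : ℝ) = ∑' n : ℕ, if n = 1 then 0 else term n := by
    rw [dampedTwist, show (fun n : ℕ ↦ (∑ χ ∈ X, χ (n : ZMod (p ^ m))) * cuspCoeff f n *
      (Real.exp (-(2 * Real.pi * n) * Y) / n : ℝ)) = term from rfl, hsum.tsum_eq_add_tsum_ite 1, ht1]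
    ring
  -- support on the integers
  have hsuppn : ∀ n : ℕ, A n ≠ 0 → ((n : ℕ) : ZMod q) ^ (2 * (p - 1)) = 1 := by
    intro n hn
    have h := hsupp (n : ZMod (p ^ m)) hn
    rwa [map_natCast] at h
  -- the majorant
  set S : ℕ → Prop := fun n ↦ ((n : ℕ) : ZMod q) ^ (2 * (p - 1)) = 1 with hS
  set g : ℕ → ℝ := fun n ↦ X.card * (C *
    (if S n ∧ 2 ≤ n then (n : ℝ) ^ (θ - 1) * Real.exp (-c * n) else 0)) with hg
  have hg0 : ∀ n, 0 ≤ g n := fun n ↦ by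
    simp only [hg]; split_ifs <;> positivity
  have hg_le : ∀ n, g n ≤ X.card * (C * ((n : ℝ) ^ (θ - 1) * Real.exp (-c * n))) := fun n ↦ by
    simp only [hg]
    split_ifs
    · exact le_rfl
    · rw [mul_zero, mul_zero]; positivity
  have hg_summable : Summable g :=
    Summable.of_nonneg_of_le hg0 hg_le (((summable_rpow_mul_exp hθ1 hcpos).mul_left C).mul_left _)
  -- pointwise comparison
  have hpt : ∀ n : ℕ, ‖(if n = 1 then (0 : ℂ) else term n)‖ ≤ g n := by
    intro n
    by_cases hn1 : n = 1
    · rw [if_pos hn1, norm_zero]; exact hg0 n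
    rw [if_neg hn1]
    rcases Nat.eq_zero_or_pos n with rfl | hnpos
    · simp only [hterm, Nat.cast_zero, div_zero, Complex.ofReal_zero, mul_zero, norm_zero]
      exact hg0 0
    have hn2 : 2 ≤ n := by omega
    by_cases hAn : A n = 0
    · simp only [hterm, hAn, zero_mul, norm_zero]; exact hg0 n
    have hSn : S n := hsuppn n hAn
    have hgn : g n = X.card * (C * ((n : ℝ) ^ (θ - 1) * Real.exp (-c * n))) := by
      simp only [hg, if_pos (And.intro hSn hn2)]
    rw [hgn, hterm]
    dsimp only
    rw [norm_mul, norm_mul, Complex.norm_real, Real.norm_of_nonneg (by positivity)]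
    have hnr : (0 : ℝ) < n := Nat.cast_pos.mpr hnpos
    calc ‖A n‖ * ‖cuspCoeff f n‖ * (Real.exp (-(2 * Real.pi * n) * Y) / n)
        ≤ X.card * (C * (n : ℝ) ^ θ) * (Real.exp (-(2 * Real.pi * n) * Y) / n) := by
          gcongr
          · exact hAle n
          · exact ha n
      _ = X.card * (C * ((n : ℝ) ^ (θ - 1) * Real.exp (-c * n))) := by
          rw [Real.rpow_sub_one hnr.ne', hc]
          field_simp
  -- partial sums of the majorant
  have hR := card_filter_pow_eq_one_le (p := p) (m - 1)
  set n₀ : ℝ := ((q : ℕ) : ℝ) ^ (1 / (2 * (p - 1) : ℝ)) with hn₀def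
  have hn₀ : 0 < n₀ := by positivity
  have hE0 : 0 ≤ n₀ ^ (θ - 1) + ((q : ℕ) : ℝ) ^ (θ - 1) * (1 + Real.Gamma θ * (c * q) ^ (-θ)) := by
    have := Real.Gamma_pos_of_pos hθ; positivity
  have hpartial : ∀ M : ℕ, ∑ n ∈ Finset.range M, g n ≤ X.card * (C * ((4 * p : ℕ) *
      (n₀ ^ (θ - 1) + ((q : ℕ) : ℝ) ^ (θ - 1) * (1 + Real.Gamma θ * (c * q) ^ (-θ))))) := by
    intro M
    simp only [hg, ← Finset.mul_sum]
    refine mul_le_mul_of_nonneg_left (mul_le_mul_of_nonneg_left ?_ hC) (Nat.cast_nonneg _)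
    have h := sum_range_indicator_rpow_mul_exp_le hθ hθ1 hcpos hq0
      (Finset.univ.filter fun r : ZMod q ↦ r ^ (2 * (p - 1)) = 1) hn₀ S
      (fun n hn ↦ by simpa [hS] using hn) (fun n hn hn2 ↦ rpow_le_of_pow_cast_eq_one hq0 hn2 hn) M
    refine h.trans ?_
    have hR' : (((Finset.univ.filter fun r : ZMod q ↦ r ^ (2 * (p - 1)) = 1).card : ℕ) : ℝ) ≤
        ((4 * p : ℕ) : ℝ) := by exact_mod_cast hR
    exact mul_le_mul_of_nonneg_right hR' hE0
  -- conclusion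
  rw [hsplit]
  refine (tsum_of_norm_bounded hg_summable.hasSum hpt).trans ?_
  refine (Real.tsum_le_of_sum_range_le hg0 hpartial).trans (le_of_eq ?_)
  rw [hn₀def, hc]

omit [NeZero N] in
/-- **The dual-term error for a sparse family.** For a cusp form `f ∈ S_2(Γ₀(N))` (below: the dual
form `g = w_N f`) with `|aₙ| ≤ C n^θ` (`0 < θ ≤ 1`), `p ∤ N`, `m ≥ 1`, `Y' > 0`, and a family `X`
of characters mod `p^m` with character sum supported in `{z : z^{2(p-1)} ≡ 1 (mod p^{m-1})}`:
`‖D_f(B, Y')‖ ≤ #X · C · (4p² · 4p^{⌈m/2⌉}) · (1 + Γ(θ)(2πY')^{-θ})`,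
`B(n) = ∑_{χ ∈ X} χ(N) τ(χ)² χ̄(n)` (as `norm_dampedTwist_dual_le` for the wild family).
[folklore] -/
theorem norm_dampedTwist_dual_le_of_support {m : ℕ} [NeZero (p ^ m)] (hm : m ≠ 0)
    (hpN : ¬ p ∣ N) (X : Finset (DirichletCharacter ℂ (p ^ m)))
    (hsupp : ∀ z : ZMod (p ^ m), ∑ χ ∈ X, χ z ≠ 0 →
      (ZMod.castHom (pow_dvd_pow p (Nat.sub_le m 1)) (ZMod (p ^ (m - 1))) z) ^ (2 * (p - 1)) = 1)
    {C θ : ℝ} (hC : 0 ≤ C) (hθ : 0 < θ) (hθ1 : θ ≤ 1)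
    (ha : ∀ n : ℕ, ‖cuspCoeff f n‖ ≤ C * (n : ℝ) ^ θ) {Y' : ℝ} (hY' : 0 < Y') :
    ‖dampedTwist f (fun n ↦ ∑ χ ∈ X,
        χ N * gaussSum χ (ZMod.stdAddChar (N := p ^ m)) ^ 2 * χ⁻¹ n) Y'‖ ≤
      X.card * (C * (((4 * p * p : ℕ) * (4 * (p : ℝ) ^ (m - m / 2))) *
        (1 + Real.Gamma θ * (2 * Real.pi * Y') ^ (-θ)))) := by
  classical
  set β : ℝ := (4 * p * p : ℕ) * (4 * (p : ℝ) ^ (m - m / 2)) with hβ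
  have hβ0 : 0 ≤ β := by positivity
  set Bw : ℕ → ℂ := fun n ↦ ∑ χ ∈ X, χ N * gaussSum χ (ZMod.stdAddChar (N := p ^ m)) ^ 2 * χ⁻¹ n
    with hBw
  set c : ℝ := 2 * Real.pi * Y' with hc
  have hcpos : 0 < c := by positivity
  have hNu : IsUnit ((N : ℕ) : ZMod (p ^ m)) := by
    rw [ZMod.isUnit_iff_coprime]
    exact ((Nat.Prime.coprime_iff_not_dvd hp.out).mpr hpN).symm.pow_right m
  -- bound for the weight
  have hBle : ∀ n : ℕ, ‖Bw n‖ ≤ X.card * β := by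
    intro n
    by_cases hn : IsUnit ((n : ℕ) : ZMod (p ^ m))
    · have : Bw n = ∑ χ ∈ X, χ ((N : ZMod (p ^ m)) * ((n : ℕ) : ZMod (p ^ m))⁻¹) *
          gaussSum χ (ZMod.stdAddChar (N := p ^ m)) ^ 2 := by
        refine Finset.sum_congr rfl fun χ _ ↦ ?_
        rw [← mul_inv_apply_eq χ _ hn]; ring
      rw [this]
      have hyu : IsUnit ((N : ZMod (p ^ m)) * ((n : ℕ) : ZMod (p ^ m))⁻¹) := by
        refine hNu.mul ?_
        rw [← hn.unit_spec, ZMod.inv_coe_unit]; exact Units.isUnit _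
      have h := norm_sum_mul_gaussSum_sq_le_of_support hm X hsupp hyu
      rw [hβ]
      refine h.trans (le_of_eq ?_)
      push_cast; ring
    · have : Bw n = 0 := Finset.sum_eq_zero fun χ _ ↦ by rw [MulChar.map_nonunit χ⁻¹ hn, mul_zero]
      rw [this, norm_zero]; positivity
  -- the majorant (zero at `n = 0`, where the term vanishes)
  set h : ℕ → ℝ := fun n ↦
    if n = 0 then 0 else X.card * β * C * ((n : ℝ) ^ (θ - 1) * Real.exp (-c * n)) with hh
  have hh0 : ∀ n, 0 ≤ h n := fun n ↦ by
    simp only [hh]; split_ifs <;> positivity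
  have hh_le : ∀ n, h n ≤ X.card * β * C * ((n : ℝ) ^ (θ - 1) * Real.exp (-c * n)) := fun n ↦ by
    simp only [hh]; split_ifs <;> first | positivity | exact le_rfl
  have hh_summable : Summable h :=
    Summable.of_nonneg_of_le hh0 hh_le ((summable_rpow_mul_exp hθ1 hcpos).mul_left _)
  have hpt : ∀ n : ℕ, ‖Bw n * cuspCoeff f n * (Real.exp (-(2 * Real.pi * n) * Y') / n : ℝ)‖ ≤ h n := by
    intro n
    rcases Nat.eq_zero_or_pos n with rfl | hnpos
    · simp only [Nat.cast_zero, div_zero, Complex.ofReal_zero, mul_zero, norm_zero]; exact hh0 0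
    have hnr : (0 : ℝ) < n := Nat.cast_pos.mpr hnpos
    rw [norm_mul, norm_mul, Complex.norm_real, Real.norm_of_nonneg (by positivity), hh]
    dsimp only
    rw [if_neg hnpos.ne']
    calc ‖Bw n‖ * ‖cuspCoeff f n‖ * (Real.exp (-(2 * Real.pi * n) * Y') / n)
        ≤ (X.card * β) * (C * (n : ℝ) ^ θ) * (Real.exp (-(2 * Real.pi * n) * Y') / n) := by
          gcongr
          · exact hBle n
          · exact ha n
      _ = X.card * β * C * ((n : ℝ) ^ (θ - 1) * Real.exp (-c * n)) := by
          rw [Real.rpow_sub_one hnr.ne', hc]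
          field_simp
  -- `∑ h ≤ #X β C (1 + Γ c^{-θ})`
  have htsum : ∑' n, h n ≤ X.card * β * C * (1 + Real.Gamma θ * c ^ (-θ)) := by
    have h0 : h 0 = 0 := by simp only [hh, if_pos rfl]
    rw [hh_summable.tsum_eq_zero_add, h0, zero_add]
    have h' : ∀ n : ℕ, h (n + 1) = X.card * β * C *
        ((((n + 1 : ℕ) : ℝ)) ^ (θ - 1) * Real.exp (-c * ((n + 1 : ℕ) : ℝ))) := fun n ↦ by
      simp only [hh, if_neg (Nat.succ_ne_zero n)]
    simp only [h']
    rw [tsum_mul_left]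
    refine mul_le_mul_of_nonneg_left ?_ (by positivity)
    refine Real.tsum_le_of_sum_range_le (fun n ↦ by positivity) fun M ↦ ?_
    exact sum_range_rpow_mul_exp_le hθ hθ1 hcpos M
  rw [dampedTwist]
  refine (tsum_of_norm_bounded hh_summable.hasSum hpt).trans (htsum.trans (le_of_eq ?_))
  rw [hβ, hc]; ring

end Errors

/-! ### Asymptotics: no admissible family of large conductor has all its symbol sums zero -/

section Final

open ModularForms UpperHalfPlane

/-- Exponent algebra for the main error term: with `X = p q`, `Y = X^{-a}`,
`q^{θ-1} (2π X^{-a} q)^{-θ} = (2π)^{-θ} p^{aθ} q^{aθ - 1}`. [folklore] -/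
private theorem main_exponent_eq' {p q θ a : ℝ} (hp : 0 < p) (hq : 0 < q) :
    q ^ (θ - 1) * (2 * Real.pi * (p * q) ^ (-a) * q) ^ (-θ) =
      (2 * Real.pi) ^ (-θ) * p ^ (a * θ) * q ^ (a * θ - 1) := by
  have h2π : (0 : ℝ) < 2 * Real.pi := Real.two_pi_pos
  have hpq : 0 < p * q := mul_pos hp hq
  rw [Real.mul_rpow (by positivity) hq.le, Real.mul_rpow h2π.le (by positivity),
    ← Real.rpow_mul hpq.le, Real.mul_rpow hp.le hq.le,
    show -a * -θ = a * θ by ring]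
  have : q ^ (θ - 1) * q ^ (a * θ) * q ^ (-θ) = q ^ (a * θ - 1) := by
    rw [← Real.rpow_add hq, ← Real.rpow_add hq]; ring_nf
  calc q ^ (θ - 1) * ((2 * Real.pi) ^ (-θ) * (p ^ (a * θ) * q ^ (a * θ)) * q ^ (-θ))
      = (2 * Real.pi) ^ (-θ) * p ^ (a * θ) * (q ^ (θ - 1) * q ^ (a * θ) * q ^ (-θ)) := by ring
    _ = _ := by rw [this]

/-- Exponent algebra for the dual error term: with `Y = X^{-a}`, `Y' = 1/(N X² Y)`,
`(2π Y')^{-θ} = (2π/N)^{-θ} X^{(2-a)θ}`. [folklore] -/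
private theorem dual_exponent_eq' {N X θ a : ℝ} (hN : 0 < N) (hX : 0 < X) :
    (2 * Real.pi * (1 / (N * X ^ 2 * X ^ (-a)))) ^ (-θ) =
      (2 * Real.pi / N) ^ (-θ) * X ^ ((2 - a) * θ) := by
  have h2π : (0 : ℝ) < 2 * Real.pi := Real.two_pi_pos
  have hX2 : X ^ 2 * X ^ (-a) = X ^ (2 - a : ℝ) := by
    rw [show X ^ 2 = X ^ (2 : ℝ) by norm_cast, ← Real.rpow_add hX, sub_eq_add_neg]
  rw [mul_assoc N, hX2, show 2 * Real.pi * (1 / (N * X ^ (2 - a : ℝ))) =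
    (2 * Real.pi / N) * (X ^ (2 - a : ℝ))⁻¹ by field_simp, Real.mul_rpow (by positivity)
    (by positivity), Real.inv_rpow (by positivity), ← Real.rpow_mul hX.le, ← Real.rpow_neg
    (by positivity)]
  congr 2
  ring

/-- `p^{⌈m/2⌉} ≤ p · (p^m)^{1/2}`. [folklore] -/
private theorem pow_ceil_half_le' {p : ℝ} (hp : 1 ≤ p) (m : ℕ) :
    p ^ (m - m / 2) ≤ p * (p ^ m) ^ (1 / 2 : ℝ) := by
  have hp0 : 0 ≤ p := by linarith
  have h2 : ((m - m / 2 : ℕ) : ℝ) ≤ 1 + m * (1 / 2 : ℝ) := by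
    have : 2 * (m - m / 2) ≤ m + 2 := by omega
    have h' : ((2 * (m - m / 2) : ℕ) : ℝ) ≤ ((m + 2 : ℕ) : ℝ) := by exact_mod_cast this
    push_cast at h'
    linarith
  calc p ^ (m - m / 2) = p ^ ((m - m / 2 : ℕ) : ℝ) := (Real.rpow_natCast p _).symm
    _ ≤ p ^ (1 + m * (1 / 2 : ℝ)) := Real.rpow_le_rpow_of_exponent_le hp h2
    _ = p * (p ^ m) ^ (1 / 2 : ℝ) := by
        rw [Real.rpow_add' hp0 (by positivity), Real.rpow_one, Real.rpow_natCast_mul hp0]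

variable {N : ℕ} [NeZero N] (f : CuspForm (CongruenceSubgroup.Gamma0 N) 2)

/-- **No admissible family of large conductor is killed by the symbol sums.** Let `f, g ∈ S_2(Γ₀(N))`
form a Fricke pair (`f(-1/(Nτ)) = N τ² g(τ)`, e.g. `g = w_N f`) with `a₁(f) = 1`,
`|aₙ(f)| ≤ C n^θ` for some `θ < 2/3`, `|bₙ(g)| ≤ C' n^{θ'}` for some `θ' ≤ 1`, and let `p ∤ N`. Then
there is `m₀` such that for every `m ≥ m₀` and every non-empty family `X` of primitive characters
mod `p^m` of constant parity whose character sum is supported in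
`{z : z^{2(p-1)} ≡ 1 (mod p^{m-1})}`, some `χ ∈ X` has `∑_a χ̄(a){∞, a/p^m}_f ≠ 0`. The threshold
`m₀` depends only on `p, N, C, θ, C', θ'`, not on the family: with `Y = p^{-am}`, `3/2 < a < 1/θ`,
the first moment over `X` equals `ε #X (e^{-2πY} + O(δ_m))` with `δ_m → 0` uniformly
(`sum_family_twistedSymbolSum_eq`, `norm_dampedTwist_sum_sub_le_of_support`,
`norm_dampedTwist_dual_le_of_support`) — Rohrlich's argument (1984, §§2–4) for the Galois average,
run here for an abstract sparse family (`exists_wildChars_twistedSymbolSum_ne_zero` is the wild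
family). [folklore] -/
theorem exists_forall_family_exists_twistedSymbolSum_ne_zero
    {g : CuspForm (CongruenceSubgroup.Gamma0 N) 2}
    (hW : IsFrickePair N f g) (hpN : ¬ p ∣ N) {C θ C' θ' : ℝ} (hC : 0 ≤ C) (hθ : 0 < θ)
    (hθ1 : θ < 2 / 3) (hC' : 0 ≤ C') (hθ' : 0 < θ') (hθ'1 : θ' ≤ 1)
    (ha : ∀ n : ℕ, ‖cuspCoeff f n‖ ≤ C * (n : ℝ) ^ θ)
    (hb : ∀ n : ℕ, ‖cuspCoeff g n‖ ≤ C' * (n : ℝ) ^ θ') (h1 : cuspCoeff f 1 = 1) :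
    ∃ m₀ : ℕ, ∀ m : ℕ, m₀ ≤ m → ∀ (X : Finset (DirichletCharacter ℂ (p ^ m))) (ε : ℂ),
      X.Nonempty → (∀ χ ∈ X, χ.IsPrimitive ∧ χ (-1) = ε) →
      (∀ z : ZMod (p ^ m), ∑ χ ∈ X, χ z ≠ 0 →
        (ZMod.castHom (pow_dvd_pow p (Nat.sub_le m 1)) (ZMod (p ^ (m - 1))) z) ^ (2 * (p - 1)) = 1) →
      ∃ χ ∈ X, twistedSymbolSum f χ⁻¹ ≠ 0 := by
  have hpr : (1 : ℝ) < p := by exact_mod_cast hp.out.one_lt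
  have hp0 : (0 : ℝ) < p := by linarith
  have hNr : (0 : ℝ) < N := Nat.cast_pos.mpr (NeZero.pos N)
  have h2π : (0 : ℝ) < 2 * Real.pi := Real.two_pi_pos
  -- the exponent `a`, `3/2 < a < 1/θ`
  set a : ℝ := 3 / 4 + 1 / (2 * θ) with hadef
  have haθ' : a * θ = 3 / 4 * θ + 1 / 2 := by
    rw [hadef]; field_simp
  have haθ : a * θ - 1 < 0 := by rw [haθ']; linarith
  have ha32 : 3 / 2 < a := by
    have : 3 / 4 < 1 / (2 * θ) := by
      rw [lt_div_iff₀ (by positivity)]; linarith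
    rw [hadef]; linarith
  have ha0 : 0 < a := by linarith
  have hdual : (2 - a) * θ' - 1 / 2 < 0 := by nlinarith [mul_pos (sub_pos.mpr ha32) hθ', hθ'1]
  -- the parameters as functions of `m`
  set X : ℕ → ℝ := fun m ↦ (p : ℝ) ^ m with hXdef
  set q : ℕ → ℝ := fun m ↦ (p : ℝ) ^ (m - 1) with hqdef
  set Y : ℕ → ℝ := fun m ↦ X m ^ (-a) with hYdef
  have hXpos : ∀ m, 0 < X m := fun m ↦ pow_pos hp0 m
  have hqpos : ∀ m, 0 < q m := fun m ↦ pow_pos hp0 _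
  have hYpos : ∀ m, 0 < Y m := fun m ↦ Real.rpow_pos_of_pos (hXpos m) _
  have hXq : ∀ m, m ≠ 0 → X m = p * q m := fun m hm ↦ by
    simp only [hXdef, hqdef]
    rw [← pow_succ', Nat.sub_add_cancel (Nat.pos_of_ne_zero hm)]
  -- the error sequences
  set e₁ : ℝ := (θ - 1) / (2 * (p - 1) : ℝ) with he₁
  set K₃ : ℝ := Real.Gamma θ * ((2 * Real.pi) ^ (-θ) * (p : ℝ) ^ (a * θ)) with hK₃
  set err₁ : ℕ → ℝ := fun m ↦ C * ((4 * p : ℕ) *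
    (q m ^ e₁ + (q m ^ (θ - 1) + K₃ * q m ^ (a * θ - 1)))) with herr₁
  set K₄ : ℝ := C' * ((4 * p * p : ℕ) * (4 * (p : ℝ))) with hK₄
  set K₅ : ℝ := Real.Gamma θ' * (2 * Real.pi / N) ^ (-θ') with hK₅
  set err₂ : ℕ → ℝ := fun m ↦ K₄ * (X m ^ (-(1 / 2 : ℝ)) + K₅ * X m ^ ((2 - a) * θ' - 1 / 2))
    with herr₂
  -- limits
  have hXlim : Tendsto X atTop atTop := tendsto_pow_atTop_atTop_of_one_lt hpr
  have hqlim : Tendsto q atTop atTop :=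
    (tendsto_pow_atTop_atTop_of_one_lt hpr).comp (tendsto_sub_atTop_nat 1)
  have hrpow : ∀ {Z : ℕ → ℝ} (_ : Tendsto Z atTop atTop) {e : ℝ} (_ : e < 0),
      Tendsto (fun m ↦ Z m ^ e) atTop (𝓝 0) := by
    intro Z hZ e he
    have h := (tendsto_rpow_neg_atTop (neg_pos.mpr he)).comp hZ
    simp only [neg_neg] at h
    exact h
  have hp1r : (1 : ℝ) ≤ (p : ℝ) - 1 := by
    have : (2 : ℝ) ≤ p := by exact_mod_cast hp.out.two_le
    linarith
  have he₁neg : e₁ < 0 := div_neg_of_neg_of_pos (by linarith) (by positivity)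
  have herr₁lim : Tendsto err₁ atTop (𝓝 0) := by
    have h := ((hrpow hqlim he₁neg).add ((hrpow hqlim (by linarith : θ - 1 < 0)).add
      ((hrpow hqlim haθ).const_mul K₃))).const_mul ((4 * p : ℕ) : ℝ)
      |>.const_mul C
    simpa [herr₁] using h
  have herr₂lim : Tendsto err₂ atTop (𝓝 0) := by
    have h := ((hrpow hXlim (by norm_num : -(1 / 2 : ℝ) < 0)).add
      ((hrpow hXlim hdual).const_mul K₅)).const_mul K₄
    simpa [herr₂] using h
  have hexplim : Tendsto (fun m ↦ Real.exp (-(2 * Real.pi) * Y m)) atTop (𝓝 1) := by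
    have hY0 : Tendsto Y atTop (𝓝 0) := hrpow hXlim (by linarith : -a < 0)
    have h0 : Tendsto (fun m ↦ -(2 * Real.pi) * Y m) atTop (𝓝 0) := by
      simpa using hY0.const_mul (-(2 * Real.pi))
    have := (Real.continuous_exp.tendsto 0).comp h0
    rw [Real.exp_zero] at this
    refine this.congr fun m ↦ ?_
    simp only [Function.comp_apply]
  -- choose `m₀`
  have hev : ∀ᶠ m in atTop, err₁ m + err₂ m < 1 / 2 ∧ 1 / 2 < Real.exp (-(2 * Real.pi) * Y m) ∧ 1 ≤ m := by
    refine ((herr₁lim.add herr₂lim).eventually (gt_mem_nhds ?_)).and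
      ((hexplim.eventually (lt_mem_nhds ?_)).and (eventually_ge_atTop 1))
    · norm_num
    · norm_num
  obtain ⟨m₀, hm₀⟩ := eventually_atTop.mp hev
  refine ⟨m₀, fun m hm Xf ε hne hXf hsupp ↦ ?_⟩
  obtain ⟨hlt, hexp, hm1⟩ := hm₀ m hm
  -- suppose all the twisted symbol sums vanish
  by_contra hall
  push Not at hall
  have hm0 : m ≠ 0 := by omega
  have hcard : 0 < (Xf.card : ℝ) := by exact_mod_cast Finset.card_pos.mpr hne
  -- `ε ≠ 0`
  have hε : ε ≠ 0 := by
    obtain ⟨χ, hχ⟩ := hne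
    rw [← (hXf χ hχ).2]
    rcases apply_neg_one_eq_one_or χ with h | h
    · rw [h]; exact one_ne_zero
    · rw [h]; exact neg_ne_zero.mpr one_ne_zero
  -- the moment vanishes
  have hmom : ∑ χ ∈ Xf, gaussSum χ (ZMod.stdAddChar (N := p ^ m)) / (p ^ m : ℂ) *
      twistedSymbolSum f χ⁻¹ = 0 :=
    Finset.sum_eq_zero fun χ hχ ↦ by rw [hall χ hχ, mul_zero]
  rw [sum_family_twistedSymbolSum_eq f hW hpN Xf hXf (hYpos m)] at hmom
  replace hmom := (mul_eq_zero.mp hmom).resolve_left hε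
  -- the two error bounds at `Y = Y m`
  have hE₁ := norm_dampedTwist_sum_sub_le_of_support f (p := p) Xf hsupp hC hθ (by linarith)
    ha h1 (hYpos m)
  have hY'pos : 0 < 1 / ((N : ℝ) * (p ^ m : ℕ) ^ 2 * Y m) := by
    have : (0 : ℝ) < (p ^ m : ℕ) := Nat.cast_pos.mpr (pow_pos hp.out.pos _)
    have := hYpos m
    positivity
  have hE₂ := norm_dampedTwist_dual_le_of_support g (p := p) hm0 hpN Xf hsupp hC' hθ' hθ'1 hb hY'pos
  -- simplify the error bounds to `#X · err₁ m` and `#X · err₂ m`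
  have hqM : ((p ^ (m - 1) : ℕ) : ℝ) = q m := by simp [hqdef]
  have hXM : ((p ^ m : ℕ) : ℝ) = X m := by simp [hXdef]
  have hA : (q m ^ (1 / (2 * (p - 1) : ℝ))) ^ (θ - 1) = q m ^ e₁ := by
    rw [← Real.rpow_mul (hqpos m).le, he₁]
    congr 1
    have : (2 * (p - 1) : ℝ) ≠ 0 := by positivity
    field_simp
  have hB : q m ^ (θ - 1) * (1 + Real.Gamma θ * (2 * Real.pi * Y m * q m) ^ (-θ)) =
      q m ^ (θ - 1) + K₃ * q m ^ (a * θ - 1) := by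
    rw [hYdef]
    dsimp only
    rw [hXq m hm0, hK₃]
    have h := main_exponent_eq' (θ := θ) (a := a) hp0 (hqpos m)
    linear_combination Real.Gamma θ * h
  have hE₁' : ‖dampedTwist f (fun n ↦ ∑ χ ∈ Xf, χ n) (Y m) -
      Xf.card * (Real.exp (-(2 * Real.pi) * Y m) : ℝ)‖ ≤ Xf.card * err₁ m := by
    have h := hE₁
    rw [hqM, hA, hB] at h
    simpa only [herr₁] using h
  have hE₂' : ‖(1 / (p ^ m : ℂ)) * dampedTwist g (fun n ↦ ∑ χ ∈ Xf,
      χ N * gaussSum χ (ZMod.stdAddChar (N := p ^ m)) ^ 2 * χ⁻¹ n) (1 / ((N : ℝ) * (p ^ m : ℕ) ^ 2 * Y m))‖ ≤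
      Xf.card * err₂ m := by
    rw [norm_mul, norm_div, norm_one, show ‖(p ^ m : ℂ)‖ = X m by
      rw [show (p ^ m : ℂ) = ((p ^ m : ℕ) : ℂ) by push_cast; rfl, Complex.norm_natCast, hXM]]
    refine (mul_le_mul_of_nonneg_left hE₂ (by positivity)).trans ?_
    rw [hXM]
    have hZ : (2 * Real.pi * (1 / ((N : ℝ) * X m ^ 2 * Y m))) ^ (-θ') =
        (2 * Real.pi / N) ^ (-θ') * X m ^ ((2 - a) * θ') := by
      rw [hYdef]; exact dual_exponent_eq' hNr (hXpos m)
    have hpk : (p : ℝ) ^ (m - m / 2) ≤ p * X m ^ (1 / 2 : ℝ) := pow_ceil_half_le' hpr.le m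
    have hG : 0 ≤ Real.Gamma θ' := (Real.Gamma_pos_of_pos hθ').le
    have hx1 : X m ^ (1 / 2 : ℝ) / X m = X m ^ (-(1 / 2 : ℝ)) := by
      rw [div_eq_iff (hXpos m).ne', ← Real.rpow_add_one (hXpos m).ne']
      norm_num
    have hx2 : X m ^ (1 / 2 : ℝ) * X m ^ ((2 - a) * θ') / X m = X m ^ ((2 - a) * θ' - 1 / 2) := by
      rw [div_eq_iff (hXpos m).ne', ← Real.rpow_add (hXpos m), ← Real.rpow_add_one (hXpos m).ne']
      congr 1; ring
    rw [hZ]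
    calc 1 / X m * ((Xf.card) * (C' * (((4 * p * p : ℕ) * (4 * (p : ℝ) ^ (m - m / 2))) *
          (1 + Real.Gamma θ' * ((2 * Real.pi / N) ^ (-θ') * X m ^ ((2 - a) * θ'))))))
        ≤ 1 / X m * ((Xf.card) * (C' * (((4 * p * p : ℕ) * (4 * ((p : ℝ) * X m ^ (1 / 2 : ℝ)))) *
          (1 + Real.Gamma θ' * ((2 * Real.pi / N) ^ (-θ') * X m ^ ((2 - a) * θ')))))) := by
          gcongr
      _ = (Xf.card) * (C' * ((4 * p * p : ℕ) * (4 * (p : ℝ)))) *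
          (X m ^ (1 / 2 : ℝ) / X m + Real.Gamma θ' * (2 * Real.pi / N) ^ (-θ') *
            (X m ^ (1 / 2 : ℝ) * X m ^ ((2 - a) * θ') / X m)) := by
          ring
      _ = (Xf.card) * err₂ m := by
          rw [hx1, hx2]
          simp only [herr₂, hK₄, hK₅]
          ring
  -- the contradiction
  have hkey : (Xf.card : ℝ) * Real.exp (-(2 * Real.pi) * Y m) ≤
      Xf.card * err₁ m + Xf.card * err₂ m := by
    have hnorm : ‖((Xf.card) * (Real.exp (-(2 * Real.pi) * Y m) : ℝ) : ℂ)‖ =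
        (Xf.card : ℝ) * Real.exp (-(2 * Real.pi) * Y m) := by
      rw [show ((Xf.card) * (Real.exp (-(2 * Real.pi) * Y m) : ℝ) : ℂ) =
        (((Xf.card) * Real.exp (-(2 * Real.pi) * Y m) : ℝ) : ℂ) by push_cast; ring,
        Complex.norm_real, Real.norm_of_nonneg (by positivity)]
    rw [← hnorm]
    set D₁ := dampedTwist f (fun n ↦ ∑ χ ∈ Xf, χ n) (Y m)
    set D₂ := (1 / (p ^ m : ℂ)) * dampedTwist g (fun n ↦ ∑ χ ∈ Xf,
      χ N * gaussSum χ (ZMod.stdAddChar (N := p ^ m)) ^ 2 * χ⁻¹ n) (1 / ((N : ℝ) * (p ^ m : ℕ) ^ 2 * Y m))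
    have hD : D₁ = D₂ := sub_eq_zero.mp hmom
    calc ‖((Xf.card) * (Real.exp (-(2 * Real.pi) * Y m) : ℝ) : ℂ)‖
        = ‖((((Xf.card) * (Real.exp (-(2 * Real.pi) * Y m) : ℝ) : ℂ) - D₁) + D₂)‖ := by
          rw [hD, sub_add_cancel]
      _ ≤ ‖((Xf.card) * (Real.exp (-(2 * Real.pi) * Y m) : ℝ) : ℂ) - D₁‖ + ‖D₂‖ :=
          norm_add_le _ _
      _ ≤ _ := by
          refine add_le_add ?_ hE₂'
          rw [norm_sub_rev]; exact hE₁'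
  have : Real.exp (-(2 * Real.pi) * Y m) ≤ err₁ m + err₂ m := by
    have h := hkey
    rw [← mul_add] at h
    exact le_of_mul_le_mul_left h hcard
  linarith

end Final

/-! ### Primitive characters of odd prime-power conductor: powers and the sub-coset -/

section PrimePow

/-- **Primitivity along coprime powers** (prime-power level, `m ≥ 1`): `χ^k` is primitive for
`χ` primitive mod `p^m` and `k` coprime to the order of `χ` (non-triviality on the kernel of
reduction mod `p^{m-1}` is preserved, `isPrimitive_iff_exists_reductionKer`). [folklore] -/
theorem isPrimitive_pow_of_coprime {m : ℕ} (hm : m ≠ 0) {χ : DirichletCharacter ℂ (p ^ m)}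
    (hχ : χ.IsPrimitive) {k : ℕ} (hk : k.Coprime (orderOf χ)) : (χ ^ k).IsPrimitive := by
  rw [isPrimitive_iff_exists_reductionKer hm] at hχ ⊢
  obtain ⟨x, hxK, hx⟩ := hχ
  refine ⟨x, hxK, ?_⟩
  rw [MulChar.pow_apply_coe]
  intro h
  apply hx
  have hd : χ (x : ZMod (p ^ m)) ^ orderOf χ = 1 := by
    rw [← MulChar.pow_apply_coe, pow_orderOf_eq_one, MulChar.one_apply_coe]
  have := pow_gcd_eq_one.mpr ⟨h, hd⟩
  rwa [hk, pow_one] at this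

/-- The order of a Dirichlet character mod `p^m` (`m ≥ 1`) divides `(p(p-1))^m`
(it divides `φ(p^m) = p^{m-1}(p-1)`). [folklore] -/
theorem orderOf_dvd_pow {m : ℕ} (hm : m ≠ 0) (χ : DirichletCharacter ℂ (p ^ m)) :
    orderOf χ ∣ (p * (p - 1)) ^ m := by
  haveI : NeZero (p ^ m) := ⟨pow_ne_zero _ hp.out.ne_zero⟩
  have h1 : orderOf χ ∣ Nat.totient (p ^ m) := by
    refine orderOf_dvd_of_pow_eq_one ?_
    ext u
    rw [MulChar.pow_apply_coe, MulChar.one_apply_coe, ← map_pow, ← Units.val_pow_eq_pow_val,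
      ZMod.pow_totient, Units.val_one, map_one]
  refine h1.trans ?_
  obtain ⟨k, rfl⟩ : ∃ k, m = k + 1 := ⟨m - 1, by omega⟩
  rw [Nat.totient_prime_pow_succ hp.out, mul_pow]
  exact mul_dvd_mul (pow_dvd_pow p (Nat.le_succ k)) (dvd_pow_self _ (Nat.succ_ne_zero k))

/-- The exponents `1 + p(p-1) j` are coprime to the order of any character mod `p^m`, `m ≥ 1`:
the members `χ^{1 + p(p-1)j}` of the sub-coset `χ⟨χ^{p(p-1)}⟩` are Galois conjugates of `χ`.
[folklore] -/
theorem coprime_one_add_mul_orderOf {m : ℕ} (hm : m ≠ 0) (χ : DirichletCharacter ℂ (p ^ m))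
    (j : ℕ) : (1 + p * (p - 1) * j).Coprime (orderOf χ) := by
  have h : (1 + p * (p - 1) * j).Coprime (p * (p - 1)) :=
    (Nat.coprime_add_mul_left_left 1 (p * (p - 1)) j).mpr (Nat.coprime_one_left _)
  exact (h.pow_right m).of_dvd_right (orderOf_dvd_pow hm χ)

end PrimePow

/-! ### Rational newforms: Galois conjugation preserves the vanishing of the symbol sums -/

section Rational

open ModularForms UpperHalfPlane

variable {N : ℕ} [NeZero N] {f : CuspForm (CongruenceSubgroup.Gamma0 N) 2}

omit [NeZero N] in
/-- `∑_a χ(a){∞, a/M}_f = ∑_a χ(a) plusSymbol(a/M) + ∑_a χ(a) minusSymbol(a/M)`. [folklore] -/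
theorem twistedSymbolSum_eq_sum_plus_add_sum_minus {M : ℕ} [NeZero M]
    (χ : DirichletCharacter ℂ M) :
    twistedSymbolSum f χ = ∑ a : ZMod M, χ a * plusSymbol f ((a.val : ℚ) / M) +
      ∑ a : ZMod M, χ a * minusSymbol f ((a.val : ℚ) / M) := by
  rw [twistedSymbolSum, ← Finset.sum_add_distrib]
  refine Finset.sum_congr rfl fun a _ ↦ ?_
  rw [plusSymbol, minusSymbol]; ring

/-- **Reflection**: `∑_a χ(a){∞, -a/M}_f = χ(-1) ∑_a χ(a){∞, a/M}_f` (substitute `a ↦ -a` and use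
`{∞, r + 1}_f = {∞, r}_f`, `modularSymbol_add_intCast_holds`). [folklore] -/
theorem sum_mul_modularSymbol_neg {M : ℕ} [NeZero M] (χ : DirichletCharacter ℂ M) :
    ∑ a : ZMod M, χ a * modularSymbol f (-((a.val : ℚ) / M)) = χ (-1) * twistedSymbolSum f χ := by
  have hM : (M : ℚ) ≠ 0 := Nat.cast_ne_zero.mpr (NeZero.ne M)
  have h : ∀ b : ZMod M,
      modularSymbol f (-(((-b).val : ℚ) / M)) = modularSymbol f ((b.val : ℚ) / M) := by
    intro b
    rcases eq_or_ne b 0 with rfl | hb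
    · simp
    · rw [ZMod.neg_val, if_neg hb, Nat.cast_sub (ZMod.val_lt b).le]
      have : -(((M : ℚ) - b.val) / M) = (b.val : ℚ) / M + ((-1 : ℤ) : ℚ) := by
        field_simp; ring
      rw [this, modularSymbol_add_intCast_holds f]
  calc ∑ a : ZMod M, χ a * modularSymbol f (-((a.val : ℚ) / M))
      = ∑ b : ZMod M, χ (-b) * modularSymbol f (-(((-b).val : ℚ) / M)) :=
        (Equiv.sum_comp (Equiv.neg (ZMod M))
          (fun a ↦ χ a * modularSymbol f (-((a.val : ℚ) / M)))).symm
    _ = ∑ b : ZMod M, χ (-1) * (χ b * modularSymbol f ((b.val : ℚ) / M)) :=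
        Finset.sum_congr rfl fun b _ ↦ by rw [h b, neg_eq_neg_one_mul, map_mul, mul_assoc]
    _ = χ (-1) * twistedSymbolSum f χ := by rw [twistedSymbolSum, Finset.mul_sum]

/-- For an **even** character the twisted symbol sum is the sum of the plus symbols:
`∑_a χ(a){∞, a/M}_f = ∑_a χ(a) plusSymbol_f(a/M)`. [folklore] -/
theorem twistedSymbolSum_eq_sum_plusSymbol {M : ℕ} [NeZero M] {χ : DirichletCharacter ℂ M}
    (hχ : χ (-1) = 1) :
    twistedSymbolSum f χ = ∑ a : ZMod M, χ a * plusSymbol f ((a.val : ℚ) / M) := by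
  have h := sum_mul_modularSymbol_neg (f := f) χ
  rw [hχ, one_mul] at h
  have h2 : ∑ a : ZMod M, χ a * plusSymbol f ((a.val : ℚ) / M) =
      (twistedSymbolSum f χ + ∑ a : ZMod M, χ a * modularSymbol f (-((a.val : ℚ) / M))) / 2 := by
    rw [twistedSymbolSum, ← Finset.sum_add_distrib, Finset.sum_div]
    refine Finset.sum_congr rfl fun a _ ↦ ?_
    rw [plusSymbol]; ring
  rw [h2, h]; ring

/-- For an **odd** character the twisted symbol sum is the sum of the minus symbols:
`∑_a χ(a){∞, a/M}_f = ∑_a χ(a) minusSymbol_f(a/M)`. [folklore] -/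
theorem twistedSymbolSum_eq_sum_minusSymbol {M : ℕ} [NeZero M] {χ : DirichletCharacter ℂ M}
    (hχ : χ (-1) = -1) :
    twistedSymbolSum f χ = ∑ a : ZMod M, χ a * minusSymbol f ((a.val : ℚ) / M) := by
  have h := sum_mul_modularSymbol_neg (f := f) χ
  rw [hχ] at h
  have h2 : ∑ a : ZMod M, χ a * minusSymbol f ((a.val : ℚ) / M) =
      (twistedSymbolSum f χ - ∑ a : ZMod M, χ a * modularSymbol f (-((a.val : ℚ) / M))) / 2 := by
    rw [twistedSymbolSum, ← Finset.sum_sub_distrib, Finset.sum_div]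
    refine Finset.sum_congr rfl fun a _ ↦ ?_
    rw [minusSymbol]; ring
  rw [h2, h]; ring

/-- **Galois conjugation preserves the vanishing of `∑_a χ(a){∞, a/M}_f` for a rational newform.**
Let `f ∈ S₂(Γ₀(N))` be a normalised newform with rational coefficients and `χ` a Dirichlet
character mod `M` with `∑_a χ(a){∞, a/M}_f = 0`. Then `∑_a χ^k(a){∞, a/M}_f = 0` for every `k`
coprime to the order of `χ`. Proof: by parity the sum is `∑ χ(a) plusSymbol(a/M)` or
`∑ χ(a) minusSymbol(a/M)`; by Manin–Drinfeld and Eichler–Shimura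
(`IsNewform0.exists_rat_smul_plusPeriod_holds`, `..._minusPeriod_holds`, with
`plusSymbol_eq_re_holds`, `minusSymbol_eq_im_mul_I_holds`) these are `Ω⁺ ∑ χ(a) q_a`, resp.
`i Ω⁻ ∑ χ(a) q_a`, with *rational* `q_a` and `Ω^± ≠ 0`; now apply
`sum_pow_apply_mul_eq_zero_of_coprime` and note that `χ^k` has the parity of `χ`. This is the
special case `σ ∈ Gal(ℚ̄/ℚ)`, `K_f = ℚ` of Shimura's theorem used by Rohrlich (1984, §1:
`L(1, f, χ) = 0 ⟹ L(1, f, χ^σ) = 0`). [folklore] -/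
theorem twistedSymbolSum_pow_eq_zero_of_coprime (hf : IsNewform0 f) (hQ : coeffField f = ⊥)
    {M : ℕ} [NeZero M] {χ : DirichletCharacter ℂ M} (h0 : twistedSymbolSum f χ = 0) {k : ℕ}
    (hk : k.Coprime (orderOf χ)) : twistedSymbolSum f (χ ^ k) = 0 := by
  have hreal : ∀ n, (cuspCoeff f n).im = 0 := cuspCoeff_im_eq_zero_of_coeffField_eq_bot hQ
  obtain ⟨hΩp, hcp⟩ := IsNewform0.exists_rat_smul_plusPeriod_holds hf hQ
  obtain ⟨hΩm, hcm⟩ := IsNewform0.exists_rat_smul_minusPeriod_holds hf hQ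
  choose cp hcp using hcp
  choose cm hcm using hcm
  have hplus : ∀ r : ℚ, plusSymbol f r = (cp r : ℂ) * (plusPeriod f : ℂ) := by
    intro r
    have h1 := plusSymbol_eq_re_holds f hreal r
    have h2 := hcp r
    rw [h1, Complex.ofReal_re] at h2
    rw [h1, h2, Rat.smul_def]
    push_cast; ring
  have hminus : ∀ r : ℚ, minusSymbol f r = (cm r : ℂ) * (minusPeriod f : ℂ) * Complex.I := by
    intro r
    have h1 := minusSymbol_eq_im_mul_I_holds f hreal r
    have h2 := hcm r
    rw [h1] at h2
    simp only [Complex.mul_im, Complex.ofReal_re, Complex.I_im, mul_one, Complex.ofReal_im,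
      Complex.I_re, mul_zero, add_zero] at h2
    rw [h1, h2, Rat.smul_def]
    push_cast; ring
  have hpar := pow_apply_neg_one_of_coprime χ hk
  rcases apply_neg_one_eq_one_or χ with heven | hodd
  · -- even: plus symbols
    have hsum : ∀ ψ : DirichletCharacter ℂ M, ψ (-1) = 1 → twistedSymbolSum f ψ =
        (plusPeriod f : ℂ) * ∑ a : ZMod M, ψ a * (cp ((a.val : ℚ) / M) : ℂ) := by
      intro ψ hψ
      rw [twistedSymbolSum_eq_sum_plusSymbol hψ, Finset.mul_sum]
      exact Finset.sum_congr rfl fun a _ ↦ by rw [hplus]; ring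
    have hz : ∑ a : ZMod M, χ a * (cp ((a.val : ℚ) / M) : ℂ) = 0 := by
      have h := hsum χ heven
      rw [h0] at h
      exact (mul_eq_zero.mp h.symm).resolve_left (Complex.ofReal_ne_zero.mpr hΩp)
    have hzk := sum_pow_apply_mul_eq_zero_of_coprime χ (fun a ↦ cp ((a.val : ℚ) / M)) hz hk
    rw [hsum (χ ^ k) (by rw [hpar, heven]), hzk, mul_zero]
  · -- odd: minus symbols
    have hsum : ∀ ψ : DirichletCharacter ℂ M, ψ (-1) = -1 → twistedSymbolSum f ψ =
        ((minusPeriod f : ℂ) * Complex.I) * ∑ a : ZMod M, ψ a * (cm ((a.val : ℚ) / M) : ℂ) := by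
      intro ψ hψ
      rw [twistedSymbolSum_eq_sum_minusSymbol hψ, Finset.mul_sum]
      exact Finset.sum_congr rfl fun a _ ↦ by rw [hminus]; ring
    have hz : ∑ a : ZMod M, χ a * (cm ((a.val : ℚ) / M) : ℂ) = 0 := by
      have h := hsum χ hodd
      rw [h0] at h
      refine (mul_eq_zero.mp h.symm).resolve_left ?_
      exact mul_ne_zero (Complex.ofReal_ne_zero.mpr hΩm) Complex.I_ne_zero
    have hzk := sum_pow_apply_mul_eq_zero_of_coprime χ (fun a ↦ cm ((a.val : ℚ) / M)) hz hk
    rw [hsum (χ ^ k) (by rw [hpar, hodd]), hzk, mul_zero]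

end Rational

/-! ### Rohrlich's theorem for rational newforms and `P = {p}` -/

section Main

open ModularForms UpperHalfPlane

variable {N : ℕ} [NeZero N] {f : CuspForm (CongruenceSubgroup.Gamma0 N) 2}

/-- **Rohrlich's non-vanishing theorem — rational newforms, twists of `p`-power conductor**
(Rohrlich 1984, Theorem, p. 409, case `ψ = 1`, `P = {p}`, `f` with rational Fourier
coefficients). Let `f ∈ S₂(Γ₀(N))` be a normalised newform with rational coefficients satisfying
`|aₙ(f)| ≤ C n^θ` for some `θ < 2/3` (e.g. the newform of an elliptic curve, by Hasse's bound),
and let `p ∤ N` be a prime. Then only finitely many primitive Dirichlet characters `χ` of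
`p`-power conductor have `L(f, χ, 1) = 0` (the value at `1` of the entire continuation of
`∑ χ(n) aₙ n⁻ˢ`) — the conclusion of `Rohrlich1984_nonvanishing_twists.primePow`, here *proved*.
Proof (Rohrlich's): if `L(f, χ, 1) = 0` then `∑_a χ̄(a){∞, a/p^m} = 0` (Birch,
`twisted_LValue_eq_holds`), hence (rationality of the periods, `twistedSymbolSum_pow_eq_zero_of_coprime`)
the same for all Galois conjugates `χ̄^k`, in particular for the inverses of all members of the
sub-coset `χ̄ · ⟨χ̄^{p(p-1)}⟩` (section `Coset`), a family of primitive characters of constant parity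
with sparse character sum (`castHom_pow_eq_one_of_apply_pow_eq_one_prime`); for `m ≥ m₀(f, p)` this
contradicts `exists_forall_family_exists_twistedSymbolSum_ne_zero` (approximate functional equation
for the Fricke pair `(f, w_N f)` and the Kloosterman bound). So all exceptional `χ` have conductor
`p^m`, `m < m₀`. [cite: RohrlichInventiones1984, Theorem (p. 409)] -/
theorem Rohrlich1984_primePow_of_coeffField_eq_bot (hf : IsNewform0 f) (hQ : coeffField f = ⊥)
    {C θ : ℝ} (hC : 0 ≤ C) (hθ : 0 < θ) (hθ1 : θ < 2 / 3)
    (ha : ∀ n : ℕ, ‖cuspCoeff f n‖ ≤ C * (n : ℝ) ^ θ) (hpN : ¬ p ∣ N) :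
    Set.Finite {χ : Σ m : ℕ, DirichletCharacter ℂ m |
      χ.1 ≠ 0 ∧ χ.1.primeFactors ⊆ {p} ∧ χ.2.IsPrimitive ∧
        ∃ L : ℂ → ℂ, Differentiable ℂ L ∧
          (∀ s : ℂ, 2 < s.re → L s = twistedLSeries f χ.2 s) ∧ L 1 = 0} := by
  classical
  -- the inputs of the family theorem for the Fricke pair `(f, w_N f)`
  have hW : IsFrickePair N f (frickeInvolution N 2 f) := isFrickePair_frickeInvolution N f
  have h1 : cuspCoeff f 1 = 1 := (isNormalized_iff_cuspCoeff_one f).mp hf.2.2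
  obtain ⟨C', hC', hb⟩ := exists_norm_cuspCoeff_le_mul (frickeInvolution N 2 f)
  have hb' : ∀ n : ℕ, ‖cuspCoeff (frickeInvolution N 2 f) n‖ ≤ C' * (n : ℝ) ^ (1 : ℝ) :=
    fun n ↦ by simpa only [Real.rpow_one] using hb n
  obtain ⟨m₀, hm₀⟩ := exists_forall_family_exists_twistedSymbolSum_ne_zero f hW hpN hC hθ hθ1
    hC'.le one_pos le_rfl ha hb' h1
  -- the finite set of characters of conductor `p^m`, `m < m₁ = max m₀ 1`
  set m₁ : ℕ := max m₀ 1 with hm₁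
  have hfin : Set.Finite (⋃ m ∈ (↑(Finset.range m₁) : Set ℕ),
      Set.range (Sigma.mk (β := fun n : ℕ ↦ DirichletCharacter ℂ n) (p ^ m))) := by
    refine (Finset.range m₁).finite_toSet.biUnion fun m _ ↦ ?_
    haveI : NeZero (p ^ m) := ⟨pow_ne_zero _ hp.out.ne_zero⟩
    exact Set.finite_range _
  refine hfin.subset ?_
  rintro ⟨n, ψ⟩ ⟨hn0, hP, hprim, L, hLd, hL, hL1⟩
  dsimp only at hn0 hP hprim hL hL1
  -- `n = p^m`
  obtain ⟨m, rfl⟩ : ∃ m, n = p ^ m := by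
    refine ⟨_, Nat.eq_prime_pow_of_unique_prime_dvd hn0 fun {d} hd hdn ↦ ?_⟩
    have : d ∈ ({p} : Finset ℕ) := hP (Nat.mem_primeFactors.mpr ⟨hd, hdn, hn0⟩)
    exact Finset.mem_singleton.mp this
  simp only [Set.mem_iUnion, Set.mem_range, Finset.coe_range, Set.mem_Iio]
  by_contra hmem
  push Not at hmem
  have hm : m₁ ≤ m := by
    by_contra hlt
    push Not at hlt
    exact hmem m hlt ψ rfl
  have hm0 : m ≠ 0 := by omega
  have hmm₀ : m₀ ≤ m := le_trans (le_max_left _ _) hm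
  -- Birch's formula: `L(f, ψ, 1) = 0` gives `∑_a ψ̄(a){∞, a/p^m}_f = 0`
  have hS : twistedSymbolSum f ψ⁻¹ = 0 := by
    have h := twisted_LValue_eq_holds f hprim hLd hL
    rw [hL1, mul_zero] at h
    exact h.symm
  set χ₁ : DirichletCharacter ℂ (p ^ m) := ψ⁻¹ with hχ₁
  have hprim₁ : χ₁.IsPrimitive := by
    rw [DirichletCharacter.isPrimitive_def, hχ₁, DirichletCharacter.conductor_inv]; exact hprim
  -- the Galois sub-coset `χ₁ ⟨χ₁^{p(p-1)}⟩`: primitive, constant parity, sparse support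
  set Xf : Finset (DirichletCharacter ℂ (p ^ m)) :=
    (Finset.range (orderOf (χ₁ ^ (p * (p - 1))))).image (fun j ↦ χ₁ * (χ₁ ^ (p * (p - 1))) ^ j)
    with hXf
  have hmem' : ∀ χ' ∈ Xf, ∃ j, χ' = χ₁ ^ (1 + p * (p - 1) * j) :=
    fun χ' h ↦ by
      obtain ⟨j, -, hj⟩ := (mem_galoisCoset_iff χ₁ (p * (p - 1))).mp h
      exact ⟨j, hj⟩
  have hX : ∀ χ' ∈ Xf, χ'.IsPrimitive ∧ χ' (-1) = χ₁ (-1) := by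
    intro χ' h
    obtain ⟨j, rfl⟩ := hmem' χ' h
    have hcop := coprime_one_add_mul_orderOf hm0 χ₁ j
    exact ⟨isPrimitive_pow_of_coprime hm0 hprim₁ hcop, pow_apply_neg_one_of_coprime χ₁ hcop⟩
  have hsupp : ∀ z : ZMod (p ^ m), ∑ χ ∈ Xf, χ z ≠ 0 →
      (ZMod.castHom (pow_dvd_pow p (Nat.sub_le m 1)) (ZMod (p ^ (m - 1))) z) ^ (2 * (p - 1)) = 1 := by
    intro z hz
    obtain ⟨hzu, hzr⟩ := isUnit_and_pow_eq_one_of_sum_galoisCoset_ne_zero χ₁ (p * (p - 1)) hz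
    obtain ⟨u, rfl⟩ := hzu
    exact castHom_pow_eq_one_of_apply_pow_eq_one_prime hm0 hprim₁ hzr
  obtain ⟨χ', hχ', hne⟩ := hm₀ m hmm₀ Xf (χ₁ (-1)) (galoisCoset_nonempty χ₁ (p * (p - 1))) hX hsupp
  -- `χ'⁻¹` is again a Galois conjugate of `χ₁ = ψ̄`, so its symbol sum vanishes: contradiction
  obtain ⟨j, rfl⟩ := hmem' χ' hχ'
  obtain ⟨hinv, hcop'⟩ := inv_pow_eq_pow_of_coprime χ₁ (coprime_one_add_mul_orderOf hm0 χ₁ j)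
  rw [hinv] at hne
  exact hne (twistedSymbolSum_pow_eq_zero_of_coprime hf hQ hS hcop')

/-- **Rohrlich's theorem for elliptic curves over `ℚ`: twists of `p`-power conductor**
(Rohrlich 1984, Theorem, p. 409, with the paper's title application: `f` the newform of an
elliptic curve `E/ℚ`, `P = {p}`). For `E = W/ℚ` elliptic, `f ∈ S₂(Γ₀(N))` its newform
(`IsNewformOf W f`) and `p ∤ N` a prime, only finitely many primitive Dirichlet characters
`χ` of `p`-power conductor have `L(E, χ, 1) = L(f, χ, 1) = 0`. Unconditional: the coefficient
bound is Hasse's (`WeierstrassCurve.norm_LFunction_le_rpow`, `|aₙ(E)| ≤ 16^{256} n^{5/8}`), the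
rationality `coeffField f = ⊥` is `IsNewformOf.coeffField_eq_bot`, and Eichler–Shimura /
Manin–Drinfeld are theorems of the tree. [cite: RohrlichInventiones1984, Theorem (p. 409)] -/
theorem Rohrlich1984_primePow_of_isNewformOf {W : WeierstrassCurve ℚ} [W.IsElliptic]
    (hfW : IsNewformOf W f) (hpN : ¬ p ∣ N) :
    Set.Finite {χ : Σ m : ℕ, DirichletCharacter ℂ m |
      χ.1 ≠ 0 ∧ χ.1.primeFactors ⊆ {p} ∧ χ.2.IsPrimitive ∧
        ∃ L : ℂ → ℂ, Differentiable ℂ L ∧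
          (∀ s : ℂ, 2 < s.re → L s = twistedLSeries f χ.2 s) ∧ L 1 = 0} :=
  Rohrlich1984_primePow_of_coeffField_eq_bot hfW.1 hfW.coeffField_eq_bot (C := (16 : ℝ) ^ 256)
    (θ := 5 / 8) (by positivity) (by norm_num) (by norm_num)
    (fun n ↦ by rw [hfW.2 n]; exact W.norm_LFunction_le_rpow n) hpN


/-- **Rohrlich's non-vanishing theorem — rational newforms, twists of odd `p`-power conductor**
(the case `p ≠ 2` of `Rohrlich1984_primePow_of_coeffField_eq_bot`, kept under its own name).
[cite: RohrlichInventiones1984, Theorem (p. 409)] -/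
theorem Rohrlich1984_oddPrimePow_of_coeffField_eq_bot (hf : IsNewform0 f) (hQ : coeffField f = ⊥)
    {C θ : ℝ} (hC : 0 ≤ C) (hθ : 0 < θ) (hθ1 : θ < 2 / 3)
    (ha : ∀ n : ℕ, ‖cuspCoeff f n‖ ≤ C * (n : ℝ) ^ θ) (_hp2 : p ≠ 2) (hpN : ¬ p ∣ N) :
    Set.Finite {χ : Σ m : ℕ, DirichletCharacter ℂ m |
      χ.1 ≠ 0 ∧ χ.1.primeFactors ⊆ {p} ∧ χ.2.IsPrimitive ∧
        ∃ L : ℂ → ℂ, Differentiable ℂ L ∧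
          (∀ s : ℂ, 2 < s.re → L s = twistedLSeries f χ.2 s) ∧ L 1 = 0} :=
  Rohrlich1984_primePow_of_coeffField_eq_bot hf hQ hC hθ hθ1 ha hpN

/-- **Rohrlich's theorem for elliptic curves over `ℚ`: twists of odd `p`-power conductor**
(the case `p ≠ 2` of `Rohrlich1984_primePow_of_isNewformOf`).
[cite: RohrlichInventiones1984, Theorem (p. 409)] -/
theorem Rohrlich1984_oddPrimePow_of_isNewformOf {W : WeierstrassCurve ℚ} [W.IsElliptic]
    (hfW : IsNewformOf W f) (_hp2 : p ≠ 2) (hpN : ¬ p ∣ N) :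
    Set.Finite {χ : Σ m : ℕ, DirichletCharacter ℂ m |
      χ.1 ≠ 0 ∧ χ.1.primeFactors ⊆ {p} ∧ χ.2.IsPrimitive ∧
        ∃ L : ℂ → ℂ, Differentiable ℂ L ∧
          (∀ s : ℂ, 2 < s.re → L s = twistedLSeries f χ.2 s) ∧ L 1 = 0} :=
  Rohrlich1984_primePow_of_isNewformOf hfW hpN

end Main

/-! ### The exact special case of the named fact: `P = {p}`, `p ∤ N` arbitrary -/

section Singleton

open ModularForms UpperHalfPlane

variable {N : ℕ} [NeZero N] {f : CuspForm (CongruenceSubgroup.Gamma0 N) 2}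

omit hp in
/-- For `p` not prime, "`p`-power conductor" means conductor `1`: the exceptional set is finite for
trivial reasons. [folklore] -/
theorem finite_setOf_primeFactors_subset_singleton_of_not_prime {p : ℕ} (hp' : ¬ p.Prime)
    (T : (Σ m : ℕ, DirichletCharacter ℂ m) → Prop) :
    Set.Finite {χ : Σ m : ℕ, DirichletCharacter ℂ m |
      χ.1 ≠ 0 ∧ χ.1.primeFactors ⊆ {p} ∧ T χ} := by
  refine (Set.finite_range (Sigma.mk (β := fun n : ℕ ↦ DirichletCharacter ℂ n) 1)).subset ?_
  rintro ⟨n, ψ⟩ ⟨hn0, hP, -⟩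
  dsimp only at hn0 hP
  have hn1 : n = 1 := by
    have hempty : n.primeFactors = ∅ := by
      rw [Finset.eq_empty_iff_forall_notMem]
      intro d hd
      have hdp : d = p := Finset.mem_singleton.mp (hP hd)
      exact hp' (hdp ▸ Nat.prime_of_mem_primeFactors hd)
    rcases Nat.primeFactors_eq_empty.mp hempty with h | h
    · exact absurd h hn0
    · exact h
  subst hn1
  exact ⟨ψ, rfl⟩

omit hp in
/-- **Rohrlich's theorem, `P = {p}`, for rational newforms** — the hypotheses of
`Rohrlich1984_nonvanishing_twists.primePow` exactly (`p ∤ N` an arbitrary natural number; for `p`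
not prime the statement is trivial), for a normalised newform with rational coefficients and a
coefficient bound `|aₙ| ≤ C n^θ`, `θ < 2/3`: the conclusion of that corollary of the named fact,
proved. [cite: RohrlichInventiones1984, Theorem (p. 409)] -/
theorem Rohrlich1984_nonvanishing_twists.primePow_of_coeffField_eq_bot (hf : IsNewform0 f)
    (hQ : coeffField f = ⊥) {C θ : ℝ} (hC : 0 ≤ C) (hθ : 0 < θ) (hθ1 : θ < 2 / 3)
    (ha : ∀ n : ℕ, ‖cuspCoeff f n‖ ≤ C * (n : ℝ) ^ θ) {p : ℕ} (hpN : ¬ p ∣ N) :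
    Set.Finite {χ : Σ m : ℕ, DirichletCharacter ℂ m |
      χ.1 ≠ 0 ∧ χ.1.primeFactors ⊆ {p} ∧ χ.2.IsPrimitive ∧
        ∃ L : ℂ → ℂ, Differentiable ℂ L ∧
          (∀ s : ℂ, 2 < s.re → L s = twistedLSeries f χ.2 s) ∧ L 1 = 0} := by
  by_cases hp' : p.Prime
  · haveI : Fact p.Prime := ⟨hp'⟩
    exact Rohrlich1984_primePow_of_coeffField_eq_bot hf hQ hC hθ hθ1 ha hpN
  · exact finite_setOf_primeFactors_subset_singleton_of_not_prime hp' _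

omit hp in
/-- **Rohrlich's theorem for elliptic curves over `ℚ`, `P = {p}`** — the conclusion of
`Rohrlich1984_nonvanishing_twists.primePow` for `f` the newform of an elliptic curve `W/ℚ` and any
`p ∤ N`, proved (Rohrlich 1984, Theorem p. 409: "for all but finitely many `χ ∈ X`,
`L(1, f, χ) ≠ 0`", with `X` the primitive Dirichlet characters unramified outside `p` and
infinity). [cite: RohrlichInventiones1984, Theorem (p. 409)] -/
theorem Rohrlich1984_nonvanishing_twists.primePow_of_isNewformOf {W : WeierstrassCurve ℚ}
    [W.IsElliptic] (hfW : IsNewformOf W f) {p : ℕ} (hpN : ¬ p ∣ N) :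
    Set.Finite {χ : Σ m : ℕ, DirichletCharacter ℂ m |
      χ.1 ≠ 0 ∧ χ.1.primeFactors ⊆ {p} ∧ χ.2.IsPrimitive ∧
        ∃ L : ℂ → ℂ, Differentiable ℂ L ∧
          (∀ s : ℂ, 2 < s.re → L s = twistedLSeries f χ.2 s) ∧ L 1 = 0} := by
  by_cases hp' : p.Prime
  · haveI : Fact p.Prime := ⟨hp'⟩
    exact Rohrlich1984_primePow_of_isNewformOf hfW hpN
  · exact finite_setOf_primeFactors_subset_singleton_of_not_prime hp' _

end Singleton

end Literature.NumberTheory.EllipticCurves
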